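import Literature.NumberTheory.GaloisRepresentations.HeckeCharacter
import Literature.NumberTheory.Automorphic.AutomorphicLFunctionProofs
import Mathlib.NumberTheory.Padics.HeightOneSpectrum
import Mathlib.NumberTheory.Padics.RingHoms
import Mathlib.Analysis.SpecialFunctions.Pow.Real
import HarnessLib

/-!
# Hecke characters: proofs (finite-order Hecke characters of `ℚ` ↔ Dirichlet characters;
convergence of the Euler product of a Hecke `L`-function)

Discharge of the named facts `Literature.NumberTheory.GaloisRepresentations.HeckeCharacter.exists_dirichletCharacter_of_isFiniteOrder`,
`Literature.NumberTheory.GaloisRepresentations.multipliable_heckeLFunction` (section `EulerProduct`, `multipliable_heckeLFunction_holds`: for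
unitary `χ` and `re s > 1` the Euler product `∏_{v ∤ 𝔣(χ)} (1 - χ(ϖ_v) N v^{-s})⁻¹` is
multipliable — Neukirch, Ch. VII §8, Prop. (8.1); the two analytic inputs `∑_v N v^{-σ} < ∞`
(`σ > 1`) and "absolute convergence passes to the product of inverses" are the tree's
`Literature.NumberTheory.Automorphic.summable_residueCard_rpow_neg` and `Literature.NumberTheory.Automorphic.summable_norm_inv_sub_one`
of `Literature.NumberTheory.Automorphic.AutomorphicLFunctionProofs`) and
`Literature.NumberTheory.GaloisRepresentations.HeckeCharacter.exists_of_dirichletCharacter` (last part,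
`HeckeCharacter.exists_of_dirichletCharacter_holds`: every Dirichlet character `χ` mod `m` comes
from a unique finite-order Hecke character `ψ` of `ℚ` with `ψ(ϖ_p) = χ(p)` for `p ∤ m`) of
`Literature.NumberTheory.GaloisRepresentations.HeckeCharacter`.

The last part makes Neukirch's `I_ℚ = ℚˣ × (ℝ_{>0} × ẑˣ)` and `C_ℚ/C_ℚ^𝔪 ≅ (ℤ/mℤ)ˣ` (Ch. VI
§1, Prop. (1.9)–(1.10)) explicit on Mathlib's adele ring: the bridge `ℚ_v ≃ ℚ_[p_v]`
(`Rat.toPadic`, Mathlib `Rat.HeightOneSpectrum.adicCompletion.padicEquiv`), the orders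
`ord_v` and the rational part `r(x) = sgn(x_∞) ∏_p p^{ord_p x} ∈ ℚˣ` of an idele (`Rat.ratPart`,
with `r((q)) = q`, `Rat.ratPart_principalIdele`, i.e. `ℚˣ ∩ (ℝ_{>0} × ẑˣ) = 1`), the unit part
`u(x) = x r(x)⁻¹` (`Rat.unitIdele`), the reduction `u ↦ (u_q q^{-ord_q u} mod q^{e_q})_{q ∣ m}`
through `PadicInt.toZModPow` and the Chinese remainder theorem `ZMod.equivPi` (`Rat.redMod`), the
ray class map `Rat.rayClassHom m : 𝕀_ℚ →* (ℤ/mℤ)ˣ` (trivial on `ℚˣ`, on `ℝ_{>0}`, on `ℤ_pˣ` for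
`p ∤ m`, on a neighbourhood of `1`, and sending `⟨p⟩_p ↦ p⁻¹ mod m`), the Hecke character
`HeckeCharacter.ofDirichlet χ = (χ ∘ rayClassHom m)⁻¹`, and the uniqueness statement
`HeckeCharacter.Rat.eq_one_of_forall` (a finite-order `ψ` unramified with `ψ(ϖ_p) = 1` for all
`p ∤ m` is trivial), proved by the approximation argument of Neukirch Ch. VI (1.9) / Ch. VII (6.13)
with an explicit Chinese-remainder step (`Rat.exists_nat_crt`).

## References

* J. Neukirch, *Algebraic Number Theory*, Grundlehren 322, Springer (1999), Ch. VII §6: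
  Prop. (6.9) (Dirichlet characters as Größencharaktere), Def. (6.11) and the paragraph following
  it (every Hecke character admits a module of definition `𝔪`), Prop. (6.12)–Cor. (6.14)
  (Hecke characters with module of definition `𝔪` vs Größencharaktere mod `𝔪`, via
  `𝔭 ↦ ⟨π_𝔭⟩`); Ch. VI §1 (ideles of `ℚ`); Ch. VII §8, Prop. (8.1) (convergence of the Euler
  product of a Hecke `L`-series on `Re(s) ≥ 1 + δ`, majorant `d · log ζ(1 + δ)` from `#{𝔭 ∣ p} ≤ d`,
  `𝔑(𝔭) ≥ p`).
-/

noncomputable section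

open NumberField IsDedekindDomain Filter Topology

namespace Literature.NumberTheory.GaloisRepresentations

/-! ### Neighbourhoods of `1` in unit groups and in the ideles -/

/-- A neighbourhood of `1` in the units `Mˣ` (units topology, induced by `x ↦ (x, x⁻¹)`)
contains `{x | ↑x ∈ U ∧ ↑x⁻¹ ∈ U}` for some neighbourhood `U` of `1` in `M`. [folklore] -/
theorem Units.exists_nhds_one_val_inv {M : Type*} [Monoid M] [TopologicalSpace M] {H : Set Mˣ}
    (hH : H ∈ 𝓝 (1 : Mˣ)) :
    ∃ U ∈ 𝓝 (1 : M), ∀ x : Mˣ, (x : M) ∈ U → ((x⁻¹ : Mˣ) : M) ∈ U → x ∈ H := by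
  rw [Units.isInducing_embedProduct.nhds_eq_comap, Filter.mem_comap] at hH
  obtain ⟨W, hW, hWH⟩ := hH
  have h1 : Units.embedProduct M 1 = (1, MulOpposite.op 1) := by simp [Units.embedProduct]
  rw [h1, mem_nhds_prod_iff] at hW
  obtain ⟨U₁, hU₁, V₂, hV₂, hUV⟩ := hW
  refine ⟨U₁ ∩ MulOpposite.op ⁻¹' V₂,
    Filter.inter_mem hU₁ (MulOpposite.continuous_op.continuousAt.preimage_mem_nhds hV₂),
    fun x hx hx' => hWH ?_⟩
  exact hUV (Set.mk_mem_prod hx.1 hx'.2)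

section Local

variable {K : Type*} [Field K] [NumberField K] (v : HeightOneSpectrum (𝓞 K))

/-- A neighbourhood of `1` in `K_v` contains a congruence ball `{y | v(y - 1) ≤ ϖ^e}`.
[folklore] -/
theorem adicCompletion_exists_ball_subset {t : Set (v.adicCompletion K)} (ht : t ∈ 𝓝 1) :
    ∃ e : ℕ, ∀ y : v.adicCompletion K, Valued.v (y - 1) ≤ WithZero.exp (-(e : ℤ)) → y ∈ t := by
  obtain ⟨γ, hγ⟩ := Valued.mem_nhds.mp ht
  have hne := (map_ne_zero_iff MonoidWithZeroHom.ValueGroup₀.embedding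
    MonoidWithZeroHom.ValueGroup₀.embedding_injective).2 γ.ne_zero
  set k : ℤ := WithZero.log (MonoidWithZeroHom.ValueGroup₀.embedding (γ.1)) with hk
  refine ⟨(1 - k).toNat, fun y hy => hγ ?_⟩
  simp only [Set.mem_setOf_eq, Valuation.restrict_lt_iff_lt_embedding]
  calc Valued.v (y - 1) ≤ WithZero.exp (-((1 - k).toNat : ℤ)) := hy
    _ < WithZero.exp k := WithZero.exp_lt_exp.2 (by omega)
    _ = _ := WithZero.exp_log hne

/-- The same for the integers `𝒪_v ⊆ K_v` (subspace topology). [folklore] -/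
theorem adicCompletionIntegers_exists_ball_subset {t : Set (v.adicCompletionIntegers K)}
    (ht : t ∈ 𝓝 1) :
    ∃ e : ℕ, ∀ y : v.adicCompletionIntegers K,
      Valued.v ((y : v.adicCompletion K) - 1) ≤ WithZero.exp (-(e : ℤ)) → y ∈ t := by
  obtain ⟨u, hu, hut⟩ := (mem_nhds_subtype _ _ _).mp ht
  obtain ⟨e, he⟩ := adicCompletion_exists_ball_subset v hu
  exact ⟨e, fun y hy => hut (he _ hy)⟩

end Local

section Global

variable {K : Type*} [Field K] [NumberField K]

/-- Components of a product of ideles (finite part). [folklore] -/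
theorem ideleGroup_val_snd_mul (x y : ideleGroup K) (v : HeightOneSpectrum (𝓞 K)) :
    ((x * y : ideleGroup K) : AdeleRing (𝓞 K) K).2 v =
      (x : AdeleRing (𝓞 K) K).2 v * (y : AdeleRing (𝓞 K) K).2 v := rfl

/-- Components of a product of ideles (infinite part). [folklore] -/
theorem ideleGroup_val_fst_mul (x y : ideleGroup K) :
    ((x * y : ideleGroup K) : AdeleRing (𝓞 K) K).1 =
      (x : AdeleRing (𝓞 K) K).1 * (y : AdeleRing (𝓞 K) K).1 := rfl

/-- The finite components of `x⁻¹` are the inverses of those of `x`. [folklore] -/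
theorem ideleGroup_val_inv_snd (x : ideleGroup K) (v : HeightOneSpectrum (𝓞 K)) :
    ((x⁻¹ : ideleGroup K) : AdeleRing (𝓞 K) K).2 v = ((x : AdeleRing (𝓞 K) K).2 v)⁻¹ := by
  have h : (x : AdeleRing (𝓞 K) K).2 v * ((x⁻¹ : ideleGroup K) : AdeleRing (𝓞 K) K).2 v = 1 := by
    rw [← ideleGroup_val_snd_mul, mul_inv_cancel]; rfl
  exact (eq_inv_of_mul_eq_one_right h)

/-- The infinite component of `x⁻¹` times that of `x` is `1`. [folklore] -/
theorem ideleGroup_val_inv_fst_mul (x : ideleGroup K) :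
    ((x⁻¹ : ideleGroup K) : AdeleRing (𝓞 K) K).1 * (x : AdeleRing (𝓞 K) K).1 = 1 := by
  rw [← ideleGroup_val_fst_mul, inv_mul_cancel]; rfl

/-- **Neighbourhoods of `1` in the idele group.**  Every neighbourhood `H` of `1` in `𝕀_K`
contains all ideles `x` with `x_∞ = 1`, `x_v ∈ 𝒪_vˣ` for all finite `v`, and
`x_v ≡ 1 (mod 𝔭_v^{e_v})` for `v` in a finite set `T` (Neukirch's `I_f^𝔪 ⊆ H` for
`𝔪 = ∏_{v ∈ T} 𝔭_v^{e_v}`).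
Ref: Neukirch, *Algebraic Number Theory*, Ch. VI §1 (basic open sets of `I_K`) and Ch. VII §6,
after Def. (6.11). [cite: NeukirchANT1999, Ch. VII §6 (6.11)] -/
theorem ideleGroup_exists_congruenceSubgroup_subset {H : Set (ideleGroup K)} (hH : H ∈ 𝓝 1) :
    ∃ T : Set (HeightOneSpectrum (𝓞 K)), T.Finite ∧ ∃ e : HeightOneSpectrum (𝓞 K) → ℕ,
      ∀ x : ideleGroup K, (x : AdeleRing (𝓞 K) K).1 = 1 →
        (∀ v, Valued.v ((x : AdeleRing (𝓞 K) K).2 v) = 1) →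
        (∀ v ∈ T, Valued.v ((x : AdeleRing (𝓞 K) K).2 v - 1) ≤ WithZero.exp (-(e v : ℤ))) →
        x ∈ H := by
  obtain ⟨U, hU, hUH⟩ := Units.exists_nhds_one_val_inv hH
  obtain ⟨U₁, hU₁, U₂, hU₂, hU12⟩ := mem_nhds_prod_iff.mp hU
  set sM := (RestrictedProduct.structureMap (fun v : HeightOneSpectrum (𝓞 K) => v.adicCompletion K)
    (fun v => (v.adicCompletionIntegers K : Set (v.adicCompletion K))) cofinite) with hsM
  have hc : Continuous (sM : _ → FiniteAdeleRing (𝓞 K) K) :=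
    RestrictedProduct.isEmbedding_structureMap.continuous
  have h1 : (sM 1 : FiniteAdeleRing (𝓞 K) K) = 1 := FiniteAdeleRing.ext K fun v => rfl
  have hpre : sM ⁻¹' U₂ ∈ 𝓝 (1 : Π v : HeightOneSpectrum (𝓞 K), v.adicCompletionIntegers K) :=
    hc.continuousAt.preimage_mem_nhds (by rw [h1]; exact hU₂)
  rw [nhds_pi, Filter.mem_pi] at hpre
  obtain ⟨I, hI, t, ht, htU⟩ := hpre
  choose e he using fun v => adicCompletionIntegers_exists_ball_subset v (ht v)
  -- an idele with unit finite components defines a point of `Π_v 𝒪_v`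
  have key : ∀ x : ideleGroup K, (x : AdeleRing (𝓞 K) K).1 = 1 →
      (∀ v, Valued.v ((x : AdeleRing (𝓞 K) K).2 v) ≤ 1) →
      (∀ v ∈ I, Valued.v ((x : AdeleRing (𝓞 K) K).2 v - 1) ≤ WithZero.exp (-(e v : ℤ))) →
      (x : AdeleRing (𝓞 K) K) ∈ U := by
    intro x hx1 hxu hxT
    set y : Π v : HeightOneSpectrum (𝓞 K), v.adicCompletionIntegers K :=
      fun v => ⟨(x : AdeleRing (𝓞 K) K).2 v, hxu v⟩ with hy
    have hy2 : (sM y : FiniteAdeleRing (𝓞 K) K) = (x : AdeleRing (𝓞 K) K).2 :=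
      FiniteAdeleRing.ext K fun v => rfl
    have hyU : y ∈ sM ⁻¹' U₂ := htU fun v hv => he v (y v) (hxT v hv)
    have : (x : AdeleRing (𝓞 K) K) =
        ((x : AdeleRing (𝓞 K) K).1, (sM y : FiniteAdeleRing (𝓞 K) K)) := Prod.ext rfl hy2.symm
    rw [this, hx1]
    exact hU12 (Set.mk_mem_prod (mem_of_mem_nhds hU₁) hyU)
  refine ⟨I, hI, e, fun x hx1 hxu hxT => hUH x (key x hx1 (fun v => (hxu v).le) hxT) ?_⟩
  refine key x⁻¹ ?_ (fun v => ?_) (fun v hv => ?_)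
  · have := ideleGroup_val_inv_fst_mul x
    rwa [hx1, mul_one] at this
  · rw [ideleGroup_val_inv_snd, map_inv₀, hxu, inv_one]
  · rw [ideleGroup_val_inv_snd]
    have hx0 : (x : AdeleRing (𝓞 K) K).2 v ≠ 0 := fun h => by simpa [h] using hxu v
    calc Valued.v (((x : AdeleRing (𝓞 K) K).2 v)⁻¹ - 1)
        = Valued.v (((x : AdeleRing (𝓞 K) K).2 v)⁻¹ * (1 - (x : AdeleRing (𝓞 K) K).2 v)) := by
          rw [mul_sub, mul_one, inv_mul_cancel₀ hx0]
      _ = Valued.v ((x : AdeleRing (𝓞 K) K).2 v - 1) := by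
          rw [map_mul, map_inv₀, hxu, inv_one, one_mul, Valuation.map_sub_swap]
      _ ≤ _ := hxT v hv

namespace HeckeCharacter

/-- The kernel of a Hecke character of finite order is a neighbourhood of `1` (its values lie in
the finite, hence discrete, set of `n`-th roots of unity). [folklore] -/
theorem ker_mem_nhds_of_isFiniteOrder {χ : HeckeCharacter K} (h : χ.IsFiniteOrder) :
    {x : ideleGroup K | χ x = 1} ∈ 𝓝 (1 : ideleGroup K) := by
  obtain ⟨n, hn, hχn⟩ := h.exists_pow_eq_one
  haveI : NeZero n := ⟨hn.ne'⟩
  set F : Set ℂˣ := {z | z ^ n = 1 ∧ z ≠ 1} with hF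
  have hFfin : F.Finite :=
    (Set.finite_range fun z : rootsOfUnity n ℂ => (z : ℂˣ)).subset fun z hz =>
      ⟨⟨z, (mem_rootsOfUnity n z).2 hz.1⟩, rfl⟩
  have hopen : IsOpen Fᶜ := hFfin.isClosed.isOpen_compl
  have h1 : χ 1 ∈ Fᶜ := by rw [map_one]; exact fun h => h.2 rfl
  filter_upwards [(map_continuous χ).continuousAt.preimage_mem_nhds (hopen.mem_nhds h1)] with x hx
  by_contra hne
  exact hx ⟨by rw [← pow_apply, hχn, one_apply], hne⟩

/-- **Every finite-order Hecke character admits a module of definition**: there are a finite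
set `T` of finite places and exponents `e_v` such that `χ(x) = 1` for every idele `x` with
`x_∞ = 1`, all `x_v ∈ 𝒪_vˣ`, and `x_v ≡ 1 (mod 𝔭_v^{e_v})` for `v ∈ T`.
Ref: Neukirch, *Algebraic Number Theory*, Ch. VII §6, paragraph after Def. (6.11).
[cite: NeukirchANT1999, Ch. VII §6 (6.11)] -/
theorem exists_moduleOfDefinition_of_isFiniteOrder {χ : HeckeCharacter K}
    (h : χ.IsFiniteOrder) :
    ∃ T : Set (HeightOneSpectrum (𝓞 K)), T.Finite ∧ ∃ e : HeightOneSpectrum (𝓞 K) → ℕ,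
      ∀ x : ideleGroup K, (x : AdeleRing (𝓞 K) K).1 = 1 →
        (∀ v, Valued.v ((x : AdeleRing (𝓞 K) K).2 v) = 1) →
        (∀ v ∈ T, Valued.v ((x : AdeleRing (𝓞 K) K).2 v - 1) ≤ WithZero.exp (-(e v : ℤ))) →
        χ x = 1 :=
  ideleGroup_exists_congruenceSubgroup_subset (ker_mem_nhds_of_isFiniteOrder h)

end HeckeCharacter

/-- The `v`-component of an idele, as a monoid hom `𝕀_K →* K_v`. [folklore] -/
def ideleGroup.finComp (v : HeightOneSpectrum (𝓞 K)) : ideleGroup K →* v.adicCompletion K where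
  toFun x := (x : AdeleRing (𝓞 K) K).2 v
  map_one' := rfl
  map_mul' _ _ := rfl

/-- The infinite component of an idele, as a monoid hom `𝕀_K →* K ⊗ ℝ`. [folklore] -/
def ideleGroup.infComp : ideleGroup K →* InfiniteAdeleRing K where
  toFun x := (x : AdeleRing (𝓞 K) K).1
  map_one' := rfl
  map_mul' _ _ := rfl

/-- Unfolding `ideleGroup.finComp`. [folklore] -/
@[simp] theorem ideleGroup.finComp_apply (v : HeightOneSpectrum (𝓞 K)) (x : ideleGroup K) :
    ideleGroup.finComp v x = (x : AdeleRing (𝓞 K) K).2 v := rfl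

/-- Unfolding `ideleGroup.infComp`. [folklore] -/
@[simp] theorem ideleGroup.infComp_apply (x : ideleGroup K) :
    ideleGroup.infComp x = (x : AdeleRing (𝓞 K) K).1 := rfl

/-- `localUnits v u` is `1` at the finite places `w ≠ v`. [folklore] -/
theorem localUnits_snd_apply_of_ne {v w : HeightOneSpectrum (𝓞 K)} (u : (v.adicCompletion K)ˣ)
    (h : w ≠ v) : (localUnits v u : AdeleRing (𝓞 K) K).2 w = 1 :=
  finiteAdeleSingle_apply_of_ne _ h

open scoped Classical in
/-- Finite components of a product of local ideles `∏_{q ∈ T} ⟨u_q⟩`. [folklore] -/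
theorem snd_prod_localUnits (T : Finset (HeightOneSpectrum (𝓞 K)))
    (u : ∀ q : HeightOneSpectrum (𝓞 K), (q.adicCompletion K)ˣ) (w : HeightOneSpectrum (𝓞 K)) :
    ((∏ q ∈ T, localUnits q (u q) : ideleGroup K) : AdeleRing (𝓞 K) K).2 w =
      if w ∈ T then ((u w : (w.adicCompletion K)ˣ) : w.adicCompletion K) else 1 := by
  rw [← ideleGroup.finComp_apply, map_prod]
  split_ifs with hw
  · rw [Finset.prod_eq_single_of_mem w hw fun q _ hq => ?_]
    · exact localUnits_snd_apply_self w (u w)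
    · exact localUnits_snd_apply_of_ne _ (Ne.symm hq)
  · exact Finset.prod_eq_one fun q hq =>
      localUnits_snd_apply_of_ne _ (fun h => hw (h ▸ hq))

/-- The infinite component of a product of local ideles is `1`. [folklore] -/
theorem fst_prod_localUnits (T : Finset (HeightOneSpectrum (𝓞 K)))
    (u : ∀ q : HeightOneSpectrum (𝓞 K), (q.adicCompletion K)ˣ) :
    ((∏ q ∈ T, localUnits q (u q) : ideleGroup K) : AdeleRing (𝓞 K) K).1 = 1 := by
  rw [← ideleGroup.infComp_apply, map_prod]
  exact Finset.prod_eq_one fun q _ => rfl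

/-- `algebraMap K K_v` is the coercion. [folklore] -/
theorem algebraMap_adicCompletion_apply (v : HeightOneSpectrum (𝓞 K)) (k : K) :
    algebraMap K (v.adicCompletion K) k = (k : v.adicCompletion K) := by
  rw [HeightOneSpectrum.algebraMap_adicCompletion]; rfl

/-- Valuation of `algebraMap K K_v k`. [folklore] -/
theorem valued_algebraMap_adicCompletion (v : HeightOneSpectrum (𝓞 K)) (k : K) :
    Valued.v (algebraMap K (v.adicCompletion K) k) = v.valuation K k := by
  rw [algebraMap_adicCompletion_apply]
  exact HeightOneSpectrum.valuedAdicCompletion_eq_valuation' v k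

/-- The local unit `k ∈ Kˣ ↦ k ∈ K_vˣ`. [folklore] -/
def globalToLocalUnits (v : HeightOneSpectrum (𝓞 K)) : Kˣ →* (v.adicCompletion K)ˣ :=
  Units.map (algebraMap K (v.adicCompletion K))

/-- Unfolding `globalToLocalUnits`. [folklore] -/
@[simp] theorem val_globalToLocalUnits (v : HeightOneSpectrum (𝓞 K)) (k : Kˣ) :
    (globalToLocalUnits v k : v.adicCompletion K) = algebraMap K (v.adicCompletion K) k := rfl

variable (K) in
omit [NumberField K] in
/-- The infinite part `k ∈ Kˣ ↦ (k)_{w ∣ ∞} ∈ (K ⊗ ℝ)ˣ` of a principal idele. [folklore] -/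
def globalToInfiniteUnits : Kˣ →* (InfiniteAdeleRing K)ˣ :=
  Units.map (algebraMap K (InfiniteAdeleRing K) : K →* InfiniteAdeleRing K)

omit [NumberField K] in
/-- Unfolding `globalToInfiniteUnits`. [folklore] -/
@[simp] theorem val_globalToInfiniteUnits (k : Kˣ) :
    (globalToInfiniteUnits K k : InfiniteAdeleRing K) = algebraMap K (InfiniteAdeleRing K) k := rfl

variable (K) in
/-- The principal idele of `k ∈ Kˣ`. [folklore] -/
def principalIdele : Kˣ →* ideleGroup K :=
  Units.map (algebraMap K (AdeleRing (𝓞 K) K) : K →* AdeleRing (𝓞 K) K)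

/-- Principal ideles are principal. [folklore] -/
theorem principalIdele_mem (k : Kˣ) : principalIdele K k ∈ principalIdeles K := ⟨k, rfl⟩

/-- Infinite component of a principal idele. [folklore] -/
@[simp] theorem principalIdele_fst (k : Kˣ) :
    (principalIdele K k : AdeleRing (𝓞 K) K).1 = algebraMap K (InfiniteAdeleRing K) k := rfl

/-- Finite components of a principal idele. [folklore] -/
@[simp] theorem principalIdele_snd (k : Kˣ) (v : HeightOneSpectrum (𝓞 K)) :
    (principalIdele K k : AdeleRing (𝓞 K) K).2 v = algebraMap K (v.adicCompletion K) k := by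
  rw [algebraMap_adicCompletion_apply]; rfl

/-- Infinite component of an infinite idele. [folklore] -/
@[simp] theorem infiniteIdeles_fst (x : (InfiniteAdeleRing K)ˣ) :
    (infiniteIdeles K x : AdeleRing (𝓞 K) K).1 = x := rfl

/-- Finite components of an infinite idele are `1`. [folklore] -/
@[simp] theorem infiniteIdeles_snd (x : (InfiniteAdeleRing K)ˣ) (v : HeightOneSpectrum (𝓞 K)) :
    (infiniteIdeles K x : AdeleRing (𝓞 K) K).2 v = 1 := rfl

end Global

/-! ### `K = ℚ` -/

section Rat

open Rat.HeightOneSpectrum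

variable (v : HeightOneSpectrum (𝓞 ℚ))

/-- `n ∈ v ↔ p_v ∣ n` for the prime `p_v = natGenerator v` under `v`. [folklore] -/
theorem Rat.natCast_mem_asIdeal_iff {n : ℕ} : (n : 𝓞 ℚ) ∈ v.asIdeal ↔ natGenerator v ∣ n := by
  rw [natGenerator_dvd_iff, ← map_natCast (Rat.IsIntegralClosure.intEquiv (𝓞 ℚ)) n,
    Ideal.apply_mem_of_equiv_iff]

/-- `n ∈ v ↔ p_v ∣ n` for integers. [folklore] -/
theorem Rat.intCast_mem_asIdeal_iff {n : ℤ} :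
    (n : 𝓞 ℚ) ∈ v.asIdeal ↔ (natGenerator v : ℤ) ∣ n := by
  rw [← Ideal.apply_mem_of_equiv_iff (f := Rat.IsIntegralClosure.intEquiv (𝓞 ℚ)), map_intCast,
    Int.cast_id, ← span_natGenerator, Ideal.mem_span_singleton]

/-- `v = (p_v)`. [folklore] -/
theorem Rat.asIdeal_eq_span_natGenerator :
    v.asIdeal = Ideal.span {(natGenerator v : 𝓞 ℚ)} := by
  apply le_antisymm
  · intro x hx
    have : Rat.IsIntegralClosure.intEquiv (𝓞 ℚ) x ∈
        v.asIdeal.map (Rat.IsIntegralClosure.intEquiv (𝓞 ℚ)) := Ideal.mem_map_of_mem _ hx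
    rw [← span_natGenerator, Ideal.mem_span_singleton] at this
    obtain ⟨c, hc⟩ := this
    rw [Ideal.mem_span_singleton]
    refine ⟨(Rat.IsIntegralClosure.intEquiv (𝓞 ℚ)).symm c, ?_⟩
    apply (Rat.IsIntegralClosure.intEquiv (𝓞 ℚ)).injective
    rw [map_mul, map_natCast, RingEquiv.apply_symm_apply, hc]
  · rw [Ideal.span_le, Set.singleton_subset_iff]
    exact (Rat.natCast_mem_asIdeal_iff v).2 dvd_rfl

/-- `N v = p_v`: the residue field of `v` has `natGenerator v` elements. [folklore] -/
theorem Rat.residueCard_eq_natGenerator : v.residueCard = natGenerator v := by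
  rw [v.residueCard_eq_card_quotient]
  have h : Ideal.span {(natGenerator v : ℤ)} =
      v.asIdeal.map (Rat.IsIntegralClosure.intEquiv (𝓞 ℚ) : 𝓞 ℚ →+* ℤ) := span_natGenerator v
  rw [Nat.card_congr ((Ideal.quotientEquiv _ _ (Rat.IsIntegralClosure.intEquiv (𝓞 ℚ)) h).trans
    (Int.quotientSpanNatEquivZMod _)).toEquiv, Nat.card_zmod]

/-- Distinct places of `ℚ` have distinct primes. [folklore] -/
theorem Rat.natGenerator_injective : Function.Injective
    (natGenerator : HeightOneSpectrum (𝓞 ℚ) → ℕ) := fun _ _ h =>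
  (primesEquiv (R := 𝓞 ℚ)).injective (Subtype.ext h)

/-- Valuation at `v` of an integer. [folklore] -/
theorem Rat.valuation_intCast (n : ℤ) : v.valuation ℚ (n : ℚ) = v.intValuation (n : 𝓞 ℚ) := by
  rw [← HeightOneSpectrum.valuation_of_algebraMap (K := ℚ)]
  exact congrArg _ (by simp)

/-- Valuation at `v` of a natural number. [folklore] -/
theorem Rat.valuation_natCast (n : ℕ) : v.valuation ℚ (n : ℚ) = v.intValuation (n : 𝓞 ℚ) := by
  exact_mod_cast Rat.valuation_intCast v n

/-- `v_p(p) = 1`. [folklore] -/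
theorem Rat.valuation_natGenerator :
    v.valuation ℚ (natGenerator v : ℚ) = WithZero.exp (-1 : ℤ) := by
  rw [Rat.valuation_natCast]
  exact v.intValuation_singleton (by exact_mod_cast (prime_natGenerator v).ne_zero)
    (Rat.asIdeal_eq_span_natGenerator v)

/-- `v_q(p) = 0` for `q ≠ p`. [folklore] -/
theorem Rat.valuation_natGenerator_of_ne {v w : HeightOneSpectrum (𝓞 ℚ)} (h : w ≠ v) :
    w.valuation ℚ (natGenerator v : ℚ) = 1 := by
  rw [Rat.valuation_natCast, HeightOneSpectrum.intValuation_eq_one_iff, Rat.natCast_mem_asIdeal_iff,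
    Nat.prime_dvd_prime_iff_eq (prime_natGenerator w) (prime_natGenerator v)]
  exact fun h' => h (Rat.natGenerator_injective h')

/-- Integers prime to `p_v` are `v`-units. [folklore] -/
theorem Rat.valuation_intCast_eq_one {n : ℤ} (h : ¬ (natGenerator v : ℤ) ∣ n) :
    v.valuation ℚ (n : ℚ) = 1 := by
  rwa [Rat.valuation_intCast, HeightOneSpectrum.intValuation_eq_one_iff,
    Rat.intCast_mem_asIdeal_iff]

/-- Integers divisible by `p_v^e` have valuation `≤ ϖ^e`. [folklore] -/
theorem Rat.valuation_intCast_le {n : ℤ} {e : ℕ} (h : (natGenerator v : ℤ) ^ e ∣ n) :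
    v.valuation ℚ (n : ℚ) ≤ WithZero.exp (-(e : ℤ)) := by
  rw [Rat.valuation_intCast, HeightOneSpectrum.intValuation_le_pow_iff_mem]
  obtain ⟨c, rfl⟩ := h
  push_cast
  exact Ideal.mul_mem_right _ _
    (Ideal.pow_mem_pow ((Rat.natCast_mem_asIdeal_iff v).2 dvd_rfl) e)

namespace HeckeCharacter

/-- A finite-order Hecke character of `ℚ` is trivial on the infinite idele `(p, 1, 1, …)` of a
positive rational `p` (indeed on `ℝ_{>0} ⊆ ℝˣ = (ℚ ⊗ ℝ)ˣ`: positive reals are `n`-th powers).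
[folklore] -/
theorem Rat.map_infiniteIdeles_natCast {ψ : HeckeCharacter ℚ} (h : ψ.IsFiniteOrder) (p : ℕ)
    (hp : (p : ℚ) ≠ 0) :
    ψ (infiniteIdeles ℚ (globalToInfiniteUnits ℚ (Units.mk0 (p : ℚ) hp))) = 1 := by
  obtain ⟨n, hn, hψn⟩ := h.exists_pow_eq_one
  have hreal : ∀ w : InfinitePlace ℚ, w.IsReal := fun w =>
    (Subsingleton.elim Rat.infinitePlace w) ▸ Rat.isReal_infinitePlace
  set u : InfiniteAdeleRing ℚ := fun w =>
    (InfinitePlace.Completion.ringEquivRealOfIsReal (hreal w)).symm ((p : ℝ) ^ (n⁻¹ : ℝ)) with hu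
  have hun : u ^ n = algebraMap ℚ (InfiniteAdeleRing ℚ) p := by
    funext w
    change (u w) ^ n = algebraMap ℚ (InfiniteAdeleRing ℚ) p w
    rw [hu, ← map_pow, Real.rpow_inv_natCast_pow p.cast_nonneg hn.ne', map_natCast,
      InfiniteAdeleRing.algebraMap_apply, ← InfinitePlace.Completion.algebraMap_apply, map_natCast]
  have hunit : IsUnit u := by
    rw [← isUnit_pow_iff hn.ne', hun]
    exact ⟨globalToInfiniteUnits ℚ (Units.mk0 (p : ℚ) hp), rfl⟩
  obtain ⟨y, hy⟩ := hunit
  have : globalToInfiniteUnits ℚ (Units.mk0 (p : ℚ) hp) = y ^ n :=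
    Units.ext (by simp [hy, hun])
  rw [this, map_pow, map_pow, ← pow_apply, hψn, one_apply]

variable (ψ : HeckeCharacter ℚ)

/-- `(T, e)` is a **module of definition** for `ψ` (finite part): `ψ` kills every idele `x` with
`x_∞ = 1`, all `x_v` units, and `x_v ≡ 1 (mod 𝔭_v^{e_v})` for `v ∈ T`.
Ref: Neukirch, *Algebraic Number Theory*, Ch. VII §6, after Def. (6.11) (`χ(I_f^𝔪) = 1`).
[cite: NeukirchANT1999, Ch. VII §6 (6.11)] -/
def IsModulus {K : Type*} [Field K] [NumberField K] (ψ : HeckeCharacter K)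
    (T : Finset (HeightOneSpectrum (𝓞 K))) (e : HeightOneSpectrum (𝓞 K) → ℕ) : Prop :=
  ∀ x : ideleGroup K, (x : AdeleRing (𝓞 K) K).1 = 1 →
    (∀ v, Valued.v ((x : AdeleRing (𝓞 K) K).2 v) = 1) →
    (∀ v ∈ T, Valued.v ((x : AdeleRing (𝓞 K) K).2 v - 1) ≤ WithZero.exp (-(e v : ℤ))) → ψ x = 1

variable (T : Finset (HeightOneSpectrum (𝓞 ℚ))) (e : HeightOneSpectrum (𝓞 ℚ) → ℕ)

/-- The integer modulus `m = 2 ∏_{q ∈ T} p_q^{e_q + 1}` attached to `(T, e)` (a multiple of the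
conductor; the factor `2` and the `+1` only ensure `1 < m` and `p_q ∣ m` for `q ∈ T`).
[folklore] -/
def Rat.modulus : ℕ := 2 * ∏ q ∈ T, natGenerator q ^ (e q + 1)

/-- `1 < m`. [folklore] -/
theorem Rat.one_lt_modulus : 1 < Rat.modulus T e := by
  have : 0 < ∏ q ∈ T, natGenerator q ^ (e q + 1) :=
    Finset.prod_pos fun q _ => pow_pos (prime_natGenerator q).pos _
  unfold Rat.modulus; omega

/-- `p_q^{e_q+1} ∣ m` for `q ∈ T`. [folklore] -/
theorem Rat.pow_dvd_modulus {q : HeightOneSpectrum (𝓞 ℚ)} (hq : q ∈ T) :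
    natGenerator q ^ (e q + 1) ∣ Rat.modulus T e :=
  dvd_mul_of_dvd_right (Finset.dvd_prod_of_mem (fun q => natGenerator q ^ (e q + 1)) hq) 2

/-- `p_q ∣ m` for `q ∈ T`. [folklore] -/
theorem Rat.dvd_modulus {q : HeightOneSpectrum (𝓞 ℚ)} (hq : q ∈ T) :
    natGenerator q ∣ Rat.modulus T e :=
  (dvd_pow_self (natGenerator q) (Nat.succ_ne_zero _)).trans (Rat.pow_dvd_modulus T e hq)

/-- Places prime to `m` lie outside `T`. [folklore] -/
theorem Rat.not_mem_of_not_dvd_modulus {v : HeightOneSpectrum (𝓞 ℚ)}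
    (hv : ¬ natGenerator v ∣ Rat.modulus T e) : v ∉ T :=
  fun h => hv (Rat.dvd_modulus T e h)

/-- Integers prime to `m` are `q`-units for `q ∈ T`. [folklore] -/
theorem Rat.not_dvd_of_coprime_modulus {a : ℕ} (ha : a.Coprime (Rat.modulus T e))
    {q : HeightOneSpectrum (𝓞 ℚ)} (hq : q ∈ T) : ¬ (natGenerator q : ℤ) ∣ (a : ℤ) := by
  intro h
  have h' : natGenerator q ∣ a := by exact_mod_cast h
  exact (prime_natGenerator q).one_lt.ne'
    (Nat.eq_one_of_dvd_coprimes ha h' (Rat.dvd_modulus T e hq))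

/-- The character `r ↦ ∏_{q ∈ T} ψ_q(r)⁻¹` of `ℚˣ`; on integers prime to `m` and modulo `m` it is
the Dirichlet character attached to `ψ` (Neukirch's `χ_f⁻¹` composed with `(ℤ/m)ˣ → ∏ 𝒪_qˣ`).
Ref: Neukirch, *Algebraic Number Theory*, Ch. VII §6, Prop. (6.13)–Cor. (6.14). [folklore] -/
def Rat.dirichletAux : ℚˣ →* ℂˣ :=
  (∏ q ∈ T, (ψ.localComponent q).comp (globalToLocalUnits q))⁻¹

/-- `dirichletAux ψ T r = ψ(∏_{q ∈ T} ⟨r⟩_q)⁻¹`. [folklore] -/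
theorem Rat.dirichletAux_apply (r : ℚˣ) :
    Rat.dirichletAux ψ T r = (ψ (∏ q ∈ T, localUnits q (globalToLocalUnits q r)))⁻¹ := by
  simp only [Rat.dirichletAux, MonoidHom.inv_apply, MonoidHom.finsetProd_apply,
    MonoidHom.coe_comp, Function.comp_apply, localComponent_apply, map_prod]

variable {ψ T e}

/-- `ψ` kills `∏_{q ∈ T} ⟨r⟩_q` when `r ≡ 1 (mod p_q^{e_q})` is a `q`-unit for all `q ∈ T`.
[folklore] -/
theorem Rat.dirichletAux_eq_one (hmod : IsModulus ψ T e) (r : ℚˣ)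
    (h1 : ∀ q ∈ T, q.valuation ℚ (r : ℚ) = 1)
    (h2 : ∀ q ∈ T, q.valuation ℚ ((r : ℚ) - 1) ≤ WithZero.exp (-(e q : ℤ))) :
    Rat.dirichletAux ψ T r = 1 := by
  classical
  rw [Rat.dirichletAux_apply, inv_eq_one]
  refine hmod _ (fst_prod_localUnits T _) (fun w => ?_) (fun w hw => ?_)
  · rw [snd_prod_localUnits]
    split_ifs with hw
    · rw [val_globalToLocalUnits, valued_algebraMap_adicCompletion]; exact h1 w hw
    · exact map_one _
  · rw [snd_prod_localUnits, if_pos hw, val_globalToLocalUnits, ← map_one (algebraMap ℚ _),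
      ← map_sub, valued_algebraMap_adicCompletion]
    exact h2 w hw

/-- **Periodicity**: on positive integers prime to `m`, `dirichletAux` only depends on the residue
mod `m`. [folklore] -/
theorem Rat.dirichletAux_congr (hmod : IsModulus ψ T e) {a b : ℕ} (ha0 : (a : ℚ) ≠ 0)
    (hb0 : (b : ℚ) ≠ 0) (ha : a.Coprime (Rat.modulus T e)) (hab : a ≡ b [MOD Rat.modulus T e]) :
    Rat.dirichletAux ψ T (Units.mk0 (a : ℚ) ha0) =
      Rat.dirichletAux ψ T (Units.mk0 (b : ℚ) hb0) := by
  have hb : b.Coprime (Rat.modulus T e) := by unfold Nat.Coprime; rw [← hab.gcd_eq]; exact ha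
  have hdvd : ((Rat.modulus T e : ℕ) : ℤ) ∣ (b : ℤ) - a := (Nat.modEq_iff_dvd.1 hab)
  set r : ℚˣ := Units.mk0 (b : ℚ) hb0 / Units.mk0 (a : ℚ) ha0 with hr
  have hrval : (r : ℚ) = b / a := rfl
  have hr1 : Rat.dirichletAux ψ T r = 1 := by
    refine Rat.dirichletAux_eq_one hmod r (fun q hq => ?_) (fun q hq => ?_)
    · rw [hrval, map_div₀, ← Int.cast_natCast b, Rat.valuation_intCast_eq_one q
        (Rat.not_dvd_of_coprime_modulus T e hb hq), ← Int.cast_natCast a,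
        Rat.valuation_intCast_eq_one q (Rat.not_dvd_of_coprime_modulus T e ha hq), div_one]
    · rw [hrval, div_sub_one ha0, map_div₀, ← Int.cast_natCast a,
        Rat.valuation_intCast_eq_one q (Rat.not_dvd_of_coprime_modulus T e ha hq), div_one,
        ← Int.cast_natCast b, ← Int.cast_sub]
      refine Rat.valuation_intCast_le q ((dvd_trans ?_ hdvd))
      exact_mod_cast (pow_dvd_pow _ (Nat.le_succ _)).trans (Rat.pow_dvd_modulus T e hq)
  have : Units.mk0 (b : ℚ) hb0 = Units.mk0 (a : ℚ) ha0 * r := (mul_div_cancel _ _).symm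
  rw [this, map_mul, hr1, mul_one]

/-- The Dirichlet character (as a hom on units of `ℤ/m`) attached to a module of definition.
[folklore] -/
theorem Rat.exists_unitHom (hmod : IsModulus ψ T e) :
    ∃ f : (ZMod (Rat.modulus T e))ˣ →* ℂˣ, ∀ (a : ℕ) (ha : a.Coprime (Rat.modulus T e))
      (ha0 : (a : ℚ) ≠ 0),
      f (ZMod.unitOfCoprime a ha) = Rat.dirichletAux ψ T (Units.mk0 a ha0) := by
  set m := Rat.modulus T e with hm
  haveI : Fact (1 < m) := ⟨Rat.one_lt_modulus T e⟩
  have hval0 : ∀ u : (ZMod m)ˣ, (((u : ZMod m).val : ℕ) : ℚ) ≠ 0 := fun u => by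
    exact_mod_cast (ZMod.val_ne_zero _).2 u.ne_zero  -- name?
  let F : (ZMod m)ˣ → ℂˣ := fun u => Rat.dirichletAux ψ T (Units.mk0 _ (hval0 u))
  have hF : ∀ (a : ℕ) (ha : a.Coprime m) (ha0 : (a : ℚ) ≠ 0),
      F (ZMod.unitOfCoprime a ha) = Rat.dirichletAux ψ T (Units.mk0 a ha0) := by
    intro a ha ha0
    refine Rat.dirichletAux_congr hmod _ ha0 ?_ ?_
    · rw [ZMod.coe_unitOfCoprime]; exact ZMod.val_coe_unit_coprime (ZMod.unitOfCoprime a ha)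
    · rw [ZMod.coe_unitOfCoprime, ZMod.val_natCast]; exact Nat.mod_modEq a m
  refine ⟨{ toFun := F, map_one' := ?_, map_mul' := fun u w => ?_ }, hF⟩
  · change Rat.dirichletAux ψ T _ = 1
    convert map_one (Rat.dirichletAux ψ T)
    exact Units.ext (by simp [ZMod.val_one])
  · change Rat.dirichletAux ψ T _ = Rat.dirichletAux ψ T _ * Rat.dirichletAux ψ T _
    rw [← map_mul]
    have h0 : (((u : ZMod m).val * (w : ZMod m).val : ℕ) : ℚ) ≠ 0 := by
      push_cast; exact mul_ne_zero (hval0 u) (hval0 w)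
    have : Units.mk0 _ (hval0 u) * Units.mk0 _ (hval0 w) =
        Units.mk0 (((u : ZMod m).val * (w : ZMod m).val : ℕ) : ℚ) h0 := Units.ext (by simp)
    rw [this]
    refine Rat.dirichletAux_congr hmod _ _ (ZMod.val_coe_unit_coprime (u * w)) ?_
    rw [Units.val_mul, ZMod.val_mul]
    exact Nat.mod_modEq _ m

/-- Places outside a module of definition are unramified. [folklore] -/
theorem isUnramifiedAt_of_isModulus (hmod : IsModulus ψ T e) {v : HeightOneSpectrum (𝓞 ℚ)}
    (hv : v ∉ T) : ψ.IsUnramifiedAt v := by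
  intro u
  rw [localComponent_apply]
  refine hmod _ (localUnits_fst v _) (fun w => ?_) (fun w hw => ?_)
  · by_cases hw : w = v
    · subst hw
      rw [localUnits_snd_apply_self]
      exact HeightOneSpectrum.adicCompletionIntegers.isUnit_iff_valued_eq_one.1 u.isUnit
    · rw [localUnits_snd_apply_of_ne _ hw, map_one]
  · rw [localUnits_snd_apply_of_ne _ (by rintro rfl; exact hv hw), sub_self, map_zero]
    exact zero_le

/-- **The value at `p ∉ T`**: `ψ(ϖ_p) = ∏_{q ∈ T} ψ_q(p)⁻¹`.  Proof: the idele
`⟨p⟩_p · (p)⁻¹ · (p)_∞ · ∏_{q ∈ T} ⟨p⟩_q` lies in `I_f^𝔪`, `ψ` is trivial on principal ideles, and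
on `(p)_∞ ∈ ℝ_{>0}` (an `n`-th power).
Ref: Neukirch, *Algebraic Number Theory*, Ch. VII §6, (6.12)–(6.14) (the map `c : 𝔭 ↦ ⟨π_𝔭⟩`).
[cite: NeukirchANT1999, Ch. VII §6 (6.14)] -/
theorem Rat.valueAtUniformizer_eq_dirichletAux (hmod : IsModulus ψ T e) (hfin : ψ.IsFiniteOrder)
    {v : HeightOneSpectrum (𝓞 ℚ)} (hv : v ∉ T)
    (hp0 : ((natGenerator v : ℕ) : ℚ) ≠ 0) :
    ψ.valueAtUniformizer v = (Rat.dirichletAux ψ T (Units.mk0 _ hp0) : ℂ) := by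
  classical
  set p := natGenerator v with hp
  set pu : ℚˣ := Units.mk0 (p : ℚ) hp0 with hpu
  have hunr := isUnramifiedAt_of_isModulus hmod hv
  -- `p` is a uniformizer at `v`
  have hϖ : Valued.v ((globalToLocalUnits v pu : (v.adicCompletion ℚ)ˣ) : v.adicCompletion ℚ) =
      WithZero.exp (-1 : ℤ) := by
    rw [val_globalToLocalUnits, valued_algebraMap_adicCompletion]
    exact Rat.valuation_natGenerator v
  rw [← localComponent_eq_valueAtUniformizer hunr hϖ, localComponent_apply]
  congr 1
  -- the auxiliary idele
  set g : ideleGroup ℚ := ∏ q ∈ T, localUnits q (globalToLocalUnits q pu) with hg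
  set z : ideleGroup ℚ := localUnits v (globalToLocalUnits v pu) * (principalIdele ℚ pu)⁻¹ *
    infiniteIdeles ℚ (globalToInfiniteUnits ℚ pu) * g with hz
  have hz1 : ψ z = 1 := by
    refine hmod z ?_ (fun w => ?_) (fun w hw => ?_)
    · rw [hz, ideleGroup_val_fst_mul, ideleGroup_val_fst_mul, ideleGroup_val_fst_mul,
        localUnits_fst, one_mul, infiniteIdeles_fst, val_globalToInfiniteUnits, hg,
        fst_prod_localUnits, mul_one, ← map_inv (principalIdele ℚ) pu, principalIdele_fst,
        ← map_mul, Units.inv_mul, map_one]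
    · rw [hz, ideleGroup_val_snd_mul, ideleGroup_val_snd_mul, ideleGroup_val_snd_mul,
        infiniteIdeles_snd, mul_one, hg, snd_prod_localUnits, ← map_inv (principalIdele ℚ) pu,
        principalIdele_snd]
      by_cases hwv : w = v
      · subst hwv
        rw [localUnits_snd_apply_self, if_neg hv, mul_one, val_globalToLocalUnits, ← map_mul,
          Units.mul_inv, map_one, map_one]
      · rw [localUnits_snd_apply_of_ne _ hwv, one_mul]
        split_ifs with hwT
        · rw [val_globalToLocalUnits, ← map_mul, Units.inv_mul, map_one, map_one]
        · rw [mul_one, valued_algebraMap_adicCompletion, Units.val_inv_eq_inv_val, map_inv₀, hpu,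
            Units.val_mk0, Rat.valuation_natGenerator_of_ne hwv, inv_one]
    · have hwv : w ≠ v := by rintro rfl; exact hv hw
      rw [hz, ideleGroup_val_snd_mul, ideleGroup_val_snd_mul, ideleGroup_val_snd_mul,
        infiniteIdeles_snd, mul_one, hg, snd_prod_localUnits, if_pos hw,
        ← map_inv (principalIdele ℚ) pu, principalIdele_snd, localUnits_snd_apply_of_ne _ hwv,
        one_mul, val_globalToLocalUnits, ← map_mul, Units.inv_mul, map_one, sub_self, map_zero]
      exact zero_le
  have hprin : ψ (principalIdele ℚ pu) = 1 := ψ.map_principal (principalIdele_mem pu)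
  have hinf : ψ (infiniteIdeles ℚ (globalToInfiniteUnits ℚ pu)) = 1 :=
    Rat.map_infiniteIdeles_natCast hfin p hp0
  have hgval : ψ g = (Rat.dirichletAux ψ T pu)⁻¹ := by rw [Rat.dirichletAux_apply, inv_inv]
  rw [hz, map_mul, map_mul, map_mul, map_inv, hprin, hinf, hgval, inv_one, mul_one, mul_one,
    mul_inv_eq_one] at hz1
  exact hz1

/-- **Finite-order Hecke characters of `ℚ` come from Dirichlet characters** (discharge of the
named fact `HeckeCharacter.exists_dirichletCharacter_of_isFiniteOrder`): for `ψ` of finite order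
there are `m ≥ 1` and a Dirichlet character `χ` mod `m` with `ψ` unramified at every `p ∤ m` and
`ψ(ϖ_p) = χ(p)`.  Here `m = 2 ∏_{q ∈ T} q^{e_q+1}` for a module of definition
`𝔪 = ∏_{q ∈ T} q^{e_q}` of `ψ` (`exists_moduleOfDefinition_of_isFiniteOrder`) and
`χ(a) = ∏_{q ∈ T} ψ_q(a)⁻¹` (`Rat.dirichletAux`), following Neukirch's correspondence
`χ ↦ χ ∘ c`, `c(𝔭) = ⟨π_𝔭⟩ mod I_f^𝔪 K^*`.
Ref: Neukirch, *Algebraic Number Theory*, Ch. VII §6, Prop. (6.9), Def. (6.11) and the paragraph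
after it, Prop. (6.12)–Cor. (6.14); Ch. VI §1. [cite: NeukirchANT1999, Ch. VII Prop. (6.9)] -/
theorem exists_dirichletCharacter_of_isFiniteOrder_holds :
    exists_dirichletCharacter_of_isFiniteOrder := by
  intro ψ hψ
  obtain ⟨T, hT, e, hmod⟩ := exists_moduleOfDefinition_of_isFiniteOrder hψ
  have hmod' : IsModulus ψ hT.toFinset e := fun x h1 h2 h3 =>
    hmod x h1 h2 fun v hv => h3 v (hT.mem_toFinset.2 hv)
  obtain ⟨f, hf⟩ := Rat.exists_unitHom hmod'
  refine ⟨Rat.modulus hT.toFinset e, ⟨(Rat.one_lt_modulus _ _).ne_bot⟩, MulChar.ofUnitHom f,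
    fun v hv => ?_⟩
  rw [Rat.natCast_mem_asIdeal_iff] at hv
  have hvT : v ∉ hT.toFinset := Rat.not_mem_of_not_dvd_modulus _ _ hv
  refine ⟨isUnramifiedAt_of_isModulus hmod' hvT, ?_⟩
  have hcop : (natGenerator v).Coprime (Rat.modulus hT.toFinset e) :=
    (Nat.Prime.coprime_iff_not_dvd (prime_natGenerator v)).2 hv
  have hp0 : ((natGenerator v : ℕ) : ℚ) ≠ 0 := by exact_mod_cast (prime_natGenerator v).ne_zero
  rw [Rat.residueCard_eq_natGenerator, ← ZMod.coe_unitOfCoprime _ hcop, MulChar.ofUnitHom_coe,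
    hf _ hcop hp0]
  exact Rat.valueAtUniformizer_eq_dirichletAux hmod' hψ hvT hp0

end HeckeCharacter

end Rat

end Literature.NumberTheory.GaloisRepresentations

/-! ### Convergence of the Euler product of a Hecke `L`-function (Neukirch, Ch. VII §8, (8.1)) -/

namespace Literature.NumberTheory.GaloisRepresentations

section EulerProduct

variable {K : Type*} [Field K] [NumberField K]

/-- **Absolutely convergent Euler products are multipliable**: if `∑_i ‖a_i‖ < ∞` in `ℂ` then
`∏_i (1 - a_i)⁻¹` is multipliable (unconditionally convergent): `∑_i ‖(1 - a_i)⁻¹ - 1‖ < ∞`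
(`Literature.NumberTheory.Automorphic.summable_norm_inv_sub_one`, with `‖(1 - a_i) - 1‖ = ‖a_i‖`), and a product
`∏ (1 + g_i)` with `∑ ‖g_i‖ < ∞` converges in the complete normed field `ℂ` (Mathlib
`multipliable_one_add_of_summable`).
Ref: Neukirch, *Algebraic Number Theory*, Ch. VII §1, proof of Prop. (1.1) (absolutely
convergent products); Ch. VII §8, proof of Prop. (8.1). [folklore] -/
theorem multipliable_inv_one_sub_of_summable_norm {ι : Type*} {a : ι → ℂ}
    (ha : Summable fun i => ‖a i‖) : Multipliable fun i => (1 - a i)⁻¹ := by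
  have hg : Summable fun i => ‖(1 - a i)⁻¹ - 1‖ :=
    Automorphic.summable_norm_inv_sub_one ha fun i => by simp
  simpa only [add_sub_cancel] using multipliable_one_add_of_summable hg

namespace HeckeCharacter

/-- A unitary Hecke character has `|χ(ϖ_v)| = 1` at every finite place. [folklore] -/
theorem norm_valueAtUniformizer_of_isUnitary {χ : HeckeCharacter K} (hχ : χ.IsUnitary)
    (v : HeightOneSpectrum (𝓞 K)) : ‖χ.valueAtUniformizer v‖ = 1 :=
  hχ _

/-- For unitary `χ`, the local factor datum `a_v = χ(ϖ_v) 𝔑(v)^{-s}` has `‖a_v‖ = 𝔑(v)^{-re s}`.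
Ref: Neukirch, *Algebraic Number Theory*, Ch. VII §8, proof of Prop. (8.1)
(`|χ(𝔭)| ≤ 1`, `|𝔑(𝔭)^s| = 𝔑(𝔭)^σ`). [folklore] -/
theorem norm_valueAtUniformizer_mul_cpow {χ : HeckeCharacter K} (hχ : χ.IsUnitary)
    (v : HeightOneSpectrum (𝓞 K)) (s : ℂ) :
    ‖χ.valueAtUniformizer v * ((v.residueCard : ℂ) ^ (-s))‖ = (v.residueCard : ℝ) ^ (-s.re) := by
  rw [norm_mul, norm_valueAtUniformizer_of_isUnitary hχ, one_mul,
    Complex.norm_natCast_cpow_of_pos (Nat.zero_lt_of_lt v.one_lt_residueCard), Complex.neg_re]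

end HeckeCharacter

/-- **Convergence of the Euler product of a Hecke `L`-function** (discharge of the named fact
`multipliable_heckeLFunction`): for a unitary Hecke character `χ` of the number field `K` and
`re s > 1`, the Euler product `∏_{v ∤ 𝔣(χ)} (1 - χ(ϖ_v) 𝔑(v)^{-s})⁻¹` over the finite places at
which `χ` is unramified is multipliable.  Proof as printed: `|χ(ϖ_v)| = 1`, so the `v`-th datum
has norm `𝔑(v)^{-σ}`, `σ = re s` (`HeckeCharacter.norm_valueAtUniformizer_mul_cpow`);
`∑_v 𝔑(v)^{-σ} < ∞` for `σ > 1` — in print by the majorant `d · log ζ(σ)` from `𝔑(𝔭) ≥ p` and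
`#{𝔭 ∣ p} ≤ d = [K:ℚ]`, in the tree `Literature.NumberTheory.Automorphic.summable_residueCard_rpow_neg` (domination
by the Dedekind zeta series) —; and an absolutely convergent product `∏ (1 - a_v)⁻¹` converges
unconditionally (`multipliable_inv_one_sub_of_summable_norm`).  The printed proposition asserts
moreover absolute and locally uniform convergence on `Re(s) ≥ 1 + δ`; the named fact is its
`Multipliable` corollary.
Ref: Neukirch, *Algebraic Number Theory*, Ch. VII §8, Prop. (8.1) (p. 435 of the held PDF).
[cite: NeukirchANT1999, Ch. VII Prop. (8.1)] -/
theorem multipliable_heckeLFunction_holds (χ : HeckeCharacter K) :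
    multipliable_heckeLFunction χ := by
  intro hχ s hs
  refine multipliable_inv_one_sub_of_summable_norm ?_
  simp_rw [HeckeCharacter.norm_valueAtUniformizer_mul_cpow hχ]
  exact (Automorphic.summable_residueCard_rpow_neg hs).comp_injective Subtype.val_injective

end EulerProduct

end Literature.NumberTheory.GaloisRepresentations

/-! ## The Hecke character of a Dirichlet character (Neukirch, Ch. VII §6 (6.9), Ch. VI §1 (1.10))

Discharge of `HeckeCharacter.exists_of_dirichletCharacter`
(`HeckeCharacter.exists_of_dirichletCharacter_holds`, at the end). -/

namespace Literature.NumberTheory.GaloisRepresentations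

open Rat.HeightOneSpectrum

section PadicBridge

variable (v : HeightOneSpectrum (𝓞 ℚ))

/-- `Fact (natGenerator v).Prime`, to speak of `ℚ_[p_v]` (local instance). [folklore] -/
theorem Rat.fact_prime_natGenerator : Fact (Nat.Prime (natGenerator v)) := ⟨prime_natGenerator v⟩

attribute [local instance] Rat.fact_prime_natGenerator

/-- Mathlib's `ℚ_v ≃ ℚ_[p_v]` (`Rat.HeightOneSpectrum.adicCompletion.padicEquiv`) as a ring
isomorphism with target `ℚ_[natGenerator v]`. [folklore] -/
def Rat.toPadic : v.adicCompletion ℚ ≃+* ℚ_[natGenerator v] :=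
  (adicCompletion.padicEquiv v : v.adicCompletion ℚ ≃A[ℚ] ℚ_[natGenerator v]).toRingEquiv

/-- Unfolding `Rat.toPadic`. [folklore] -/
theorem Rat.toPadic_apply (x : v.adicCompletion ℚ) :
    Rat.toPadic v x = adicCompletion.padicEquiv v x := rfl

/-- `toPadic` commutes with the maps from `ℚ`. [folklore] -/
theorem Rat.toPadic_algebraMap (q : ℚ) :
    Rat.toPadic v (algebraMap ℚ (v.adicCompletion ℚ) q) = (q : ℚ_[natGenerator v]) := by
  rw [eq_ratCast (algebraMap ℚ (v.adicCompletion ℚ)) q, map_ratCast]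

/-- `‖toPadic x‖ ≤ 1 ↔ v(x) ≤ 1`. [folklore] -/
theorem Rat.norm_toPadic_le_one_iff (x : v.adicCompletion ℚ) :
    ‖Rat.toPadic v x‖ ≤ 1 ↔ Valued.v x ≤ 1 := by
  have hb := adicCompletion.padicEquiv_bijOn (R := 𝓞 ℚ) v
  constructor
  · intro h
    obtain ⟨y, hy, hyx⟩ := hb.surjOn (show Rat.toPadic v x ∈ PadicInt.subring _ from h)
    have : y = x := (adicCompletion.padicEquiv v).injective hyx
    rw [← this]
    exact hy
  · intro h
    exact hb.mapsTo (show x ∈ v.adicCompletionIntegers ℚ from h)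

/-- `v(p_v) = ϖ` in `ℚ_v`. [folklore] -/
theorem Rat.valued_natGenerator :
    Valued.v ((natGenerator v : ℕ) : v.adicCompletion ℚ) = WithZero.exp (-1 : ℤ) := by
  rw [← map_natCast (algebraMap ℚ (v.adicCompletion ℚ)), valued_algebraMap_adicCompletion]
  exact Rat.valuation_natGenerator v

/-- `p_v ≠ 0` in `ℚ_v`. [folklore] -/
theorem Rat.natGenerator_ne_zero' : ((natGenerator v : ℕ) : v.adicCompletion ℚ) ≠ 0 := by
  intro h
  have := Rat.valued_natGenerator v
  rw [h, map_zero] at this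
  exact WithZero.coe_ne_zero this.symm

/-- `v(x) ≤ ϖ^k ↔ ‖toPadic x‖ ≤ p^{-k}`. [folklore] -/
theorem Rat.valued_le_iff_norm_toPadic_le (x : v.adicCompletion ℚ) (k : ℕ) :
    Valued.v x ≤ WithZero.exp (-(k : ℤ)) ↔
      ‖Rat.toPadic v x‖ ≤ (natGenerator v : ℝ) ^ (-(k : ℤ)) := by
  set p := natGenerator v with hp
  set π : v.adicCompletion ℚ := (p : v.adicCompletion ℚ) with hπ
  have hπ0 : π ≠ 0 := Rat.natGenerator_ne_zero' v
  have hπk : Valued.v (π ^ k) = WithZero.exp (-(k : ℤ)) := by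
    rw [map_pow, hπ, Rat.valued_natGenerator, ← WithZero.exp_nsmul]; simp
  have hx : x = π ^ k * (x / π ^ k) := by rw [mul_div_cancel₀ _ (pow_ne_zero _ hπ0)]
  have hp1 : (1 : ℝ) < p := by exact_mod_cast (prime_natGenerator v).one_lt
  have key : ‖Rat.toPadic v x‖ = (p : ℝ) ^ (-(k : ℤ)) * ‖Rat.toPadic v (x / π ^ k)‖ := by
    conv_lhs => rw [hx]
    rw [map_mul, norm_mul, map_pow, hπ, map_natCast]
    simp [zpow_neg, zpow_natCast]
  rw [key]
  conv_lhs => rw [hx]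
  rw [map_mul, hπk]
  have hpk : (0 : ℝ) < (p : ℝ) ^ (-(k : ℤ)) := zpow_pos (by positivity) _
  rw [mul_le_iff_le_one_right hpk, Rat.norm_toPadic_le_one_iff]
  constructor
  · intro h
    have h' := mul_le_mul_right h (WithZero.exp (k : ℤ))
    rwa [← mul_assoc, ← WithZero.exp_add, add_neg_cancel, WithZero.exp_zero, one_mul] at h'
  · intro h
    calc WithZero.exp (-(k : ℤ)) * Valued.v (x / π ^ k) ≤ WithZero.exp (-(k : ℤ)) * 1 :=
          mul_le_mul_right h _
      _ = _ := mul_one _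

/-- `‖toPadic x‖ = 1 ↔ v(x) = 1`. [folklore] -/
theorem Rat.norm_toPadic_eq_one_iff (x : v.adicCompletion ℚ) :
    ‖Rat.toPadic v x‖ = 1 ↔ Valued.v x = 1 := by
  by_cases hx : x = 0
  · subst hx; simp
  have h1 := Rat.norm_toPadic_le_one_iff v x
  have h2 := Rat.norm_toPadic_le_one_iff v x⁻¹
  rw [map_inv₀, norm_inv, map_inv₀, inv_le_one₀ (norm_pos_iff.2 ((map_ne_zero _).2 hx)),
    inv_le_one₀ (zero_lt_iff.2 ((map_ne_zero _).2 hx))] at h2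
  constructor
  · intro h; exact le_antisymm (h1.1 h.le) (h2.1 h.ge)
  · intro h; exact le_antisymm (h1.2 h.le) (h2.2 h.ge)

end PadicBridge

section IdeleRat

variable {K : Type*} [Field K] [NumberField K]

/-- The finite components of an idele are nonzero. [folklore] -/
theorem ideleGroup_snd_ne_zero (x : ideleGroup K) (v : HeightOneSpectrum (𝓞 K)) :
    (x : AdeleRing (𝓞 K) K).2 v ≠ 0 := by
  intro h
  have := ideleGroup_val_snd_mul x x⁻¹ v
  rw [mul_inv_cancel, h, zero_mul] at this
  exact one_ne_zero this

/-- Almost all finite components of an idele are units. [folklore] -/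
theorem ideleGroup_valued_snd_eventually_eq_one (x : ideleGroup K) :
    ∀ᶠ v in cofinite, Valued.v ((x : AdeleRing (𝓞 K) K).2 v) = 1 := by
  have hu : IsUnit (x : AdeleRing (𝓞 K) K).2 :=
    IsUnit.of_mul_eq_one ((x⁻¹ : ideleGroup K) : AdeleRing (𝓞 K) K).2
      (FiniteAdeleRing.ext K fun v => by
        change ((x * x⁻¹ : ideleGroup K) : AdeleRing (𝓞 K) K).2 v = (1 : FiniteAdeleRing (𝓞 K) K) v
        rw [mul_inv_cancel]; rfl)
  exact (FiniteAdeleRing.isUnit_iff.1 hu).2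

variable (v : HeightOneSpectrum (𝓞 ℚ))

attribute [local instance] Rat.fact_prime_natGenerator

/-- The `v`-component of an idele of `ℚ`, read in `ℚ_[p_v]`. [folklore] -/
def Rat.padicComp : ideleGroup ℚ →* ℚ_[natGenerator v] :=
  (Rat.toPadic v).toRingHom.toMonoidHom.comp (ideleGroup.finComp v)

/-- Unfolding `Rat.padicComp`. [folklore] -/
theorem Rat.padicComp_apply (x : ideleGroup ℚ) :
    Rat.padicComp v x = Rat.toPadic v ((x : AdeleRing (𝓞 ℚ) ℚ).2 v) := rfl

/-- `Rat.padicComp v x ≠ 0`. [folklore] -/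
theorem Rat.padicComp_ne_zero (x : ideleGroup ℚ) : Rat.padicComp v x ≠ 0 := by
  rw [Rat.padicComp_apply, map_ne_zero]
  exact ideleGroup_snd_ne_zero x v

/-- The `p_v`-adic order `ord_v(x) ∈ ℤ` of the `v`-component of an idele of `ℚ`. [folklore] -/
def Rat.ord (x : ideleGroup ℚ) : ℤ := (Rat.padicComp v x).valuation

/-- `ord_v` is additive. [folklore] -/
theorem Rat.ord_mul (x y : ideleGroup ℚ) : Rat.ord v (x * y) = Rat.ord v x + Rat.ord v y := by
  unfold Rat.ord
  rw [map_mul]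
  exact Padic.valuation_mul (Rat.padicComp_ne_zero v x) (Rat.padicComp_ne_zero v y)

/-- `ord_v 1 = 0`. [folklore] -/
theorem Rat.ord_one : Rat.ord v 1 = 0 := by
  unfold Rat.ord; rw [map_one]; exact Padic.valuation_one

/-- `ord_v x⁻¹ = - ord_v x`. [folklore] -/
theorem Rat.ord_inv (x : ideleGroup ℚ) : Rat.ord v x⁻¹ = -Rat.ord v x := by
  have := Rat.ord_mul v x x⁻¹
  rw [mul_inv_cancel, Rat.ord_one] at this
  omega

/-- `‖x_v‖_p = p^{-ord_v x}`. [folklore] -/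
theorem Rat.norm_padicComp (x : ideleGroup ℚ) :
    ‖Rat.padicComp v x‖ = (natGenerator v : ℝ) ^ (-Rat.ord v x) :=
  Padic.norm_eq_zpow_neg_valuation (Rat.padicComp_ne_zero v x)

/-- `ord_v x = 0 ↔ x_v` is a `v`-adic unit. [folklore] -/
theorem Rat.ord_eq_zero_iff (x : ideleGroup ℚ) :
    Rat.ord v x = 0 ↔ Valued.v ((x : AdeleRing (𝓞 ℚ) ℚ).2 v) = 1 := by
  rw [← Rat.norm_toPadic_eq_one_iff, ← Rat.padicComp_apply, Rat.norm_padicComp]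
  have hp : (1 : ℝ) < natGenerator v := by exact_mod_cast (prime_natGenerator v).one_lt
  constructor
  · intro h; rw [h, neg_zero, zpow_zero]
  · intro h
    have := zpow_right_injective₀ (zero_lt_one.trans hp) hp.ne' (h.trans (zpow_zero _).symm)
    simpa using this

/-- `ord_v` of a principal idele is the `p_v`-adic valuation. [folklore] -/
theorem Rat.ord_principalIdele (q : ℚˣ) :
    Rat.ord v (principalIdele ℚ q) = padicValRat (natGenerator v) q := by
  unfold Rat.ord
  rw [Rat.padicComp_apply, principalIdele_snd, Rat.toPadic_algebraMap, Padic.valuation_ratCast]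

/-- `ord_v x = 0` for almost all `v`. [folklore] -/
theorem Rat.ord_eventually_eq_zero (x : ideleGroup ℚ) : ∀ᶠ v in cofinite, Rat.ord v x = 0 := by
  filter_upwards [ideleGroup_valued_snd_eventually_eq_one x] with v hv
  exact (Rat.ord_eq_zero_iff v x).2 hv

/-- The prime `p_v` as a unit of `ℚ`. [folklore] -/
def Rat.primeUnit : ℚˣ :=
  Units.mk0 (natGenerator v : ℚ) (by exact_mod_cast (prime_natGenerator v).ne_zero)

/-- Unfolding `Rat.primeUnit`. [folklore] -/
@[simp] theorem Rat.val_primeUnit : (Rat.primeUnit v : ℚ) = natGenerator v := rfl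

/-- The family `v ↦ p_v ^ ord_v x` has finite multiplicative support. [folklore] -/
theorem Rat.hasFiniteMulSupport_pow_ord (x : ideleGroup ℚ) :
    Function.HasFiniteMulSupport fun v => Rat.primeUnit v ^ Rat.ord v x := by
  refine (Filter.eventually_cofinite.1 (Rat.ord_eventually_eq_zero x)).subset fun v hv => ?_
  intro h0
  exact hv (by simp only [h0, zpow_zero])

/-! Infinite component. -/

/-- Every infinite place of `ℚ` is real. [folklore] -/
theorem Rat.isReal_infinitePlace' (w : InfinitePlace ℚ) : w.IsReal :=
  (Subsingleton.elim Rat.infinitePlace w) ▸ Rat.isReal_infinitePlace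

/-- `ℚ_w ≃+* ℝ` for an infinite place `w` of `ℚ`. [folklore] -/
def Rat.completionRealEquiv (w : InfinitePlace ℚ) : w.Completion ≃+* ℝ :=
  InfinitePlace.Completion.ringEquivRealOfIsReal (Rat.isReal_infinitePlace' w)

/-- The infinite component of an idele of `ℚ`, as a real number (a monoid hom `𝕀_ℚ →* ℝ`).
[folklore] -/
def Rat.infReal : ideleGroup ℚ →* ℝ :=
  (((Rat.completionRealEquiv Rat.infinitePlace).toRingHom.comp
    ((Pi.evalRingHom (fun w : InfinitePlace ℚ => w.Completion) Rat.infinitePlace).comp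
      (RingHom.fst (InfiniteAdeleRing ℚ) (FiniteAdeleRing (𝓞 ℚ) ℚ)))).toMonoidHom).comp
    (Units.coeHom (AdeleRing (𝓞 ℚ) ℚ))

/-- Unfolding `Rat.infReal`. [folklore] -/
theorem Rat.infReal_apply (x : ideleGroup ℚ) :
    Rat.infReal x =
      Rat.completionRealEquiv Rat.infinitePlace ((x : AdeleRing (𝓞 ℚ) ℚ).1 Rat.infinitePlace) :=
  rfl

/-- `Rat.infReal x ≠ 0`. [folklore] -/
theorem Rat.infReal_ne_zero (x : ideleGroup ℚ) : Rat.infReal x ≠ 0 := by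
  intro h
  have := map_mul Rat.infReal x x⁻¹
  rw [mul_inv_cancel, map_one, h, zero_mul] at this
  exact one_ne_zero this

/-- The infinite component of a principal idele. [folklore] -/
theorem Rat.infReal_principalIdele (q : ℚˣ) : Rat.infReal (principalIdele ℚ q) = (q : ℝ) := by
  rw [Rat.infReal_apply, principalIdele_fst, InfiniteAdeleRing.algebraMap_apply,
    ← InfinitePlace.Completion.algebraMap_apply]
  exact eq_ratCast ((Rat.completionRealEquiv Rat.infinitePlace).toRingHom.comp
    (algebraMap ℚ _)) q

/-- The sign of the infinite component, as a hom `𝕀_ℚ →* ℚˣ` (values `±1`). [folklore] -/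
def Rat.infSign : ideleGroup ℚ →* ℚˣ where
  toFun x := if 0 < Rat.infReal x then 1 else -1
  map_one' := by simp
  map_mul' x y := by
    have hx := Rat.infReal_ne_zero x
    have hy := Rat.infReal_ne_zero y
    rw [map_mul]
    rcases lt_or_gt_of_ne hx with hx | hx <;> rcases lt_or_gt_of_ne hy with hy | hy
    · rw [if_pos (mul_pos_of_neg_of_neg hx hy), if_neg hx.not_gt, if_neg hy.not_gt]; simp
    · rw [if_neg (mul_neg_of_neg_of_pos hx hy).not_gt, if_neg hx.not_gt, if_pos hy]; simp
    · rw [if_neg (mul_neg_of_pos_of_neg hx hy).not_gt, if_pos hx, if_neg hy.not_gt]; simp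
    · rw [if_pos (mul_pos hx hy), if_pos hx, if_pos hy]; simp

/-- Unfolding `Rat.infSign`. [folklore] -/
theorem Rat.infSign_apply (x : ideleGroup ℚ) :
    Rat.infSign x = if 0 < Rat.infReal x then 1 else -1 := rfl

/-- `(infSign x : ℝ) * |x_∞| = x_∞`. [folklore] -/
theorem Rat.infSign_mul_abs (x : ideleGroup ℚ) :
    ((Rat.infSign x : ℚ) : ℝ) * |Rat.infReal x| = Rat.infReal x := by
  rw [Rat.infSign_apply]
  split_ifs with h
  · simp [abs_of_pos h]
  · have : Rat.infReal x < 0 := lt_of_le_of_ne (not_lt.1 h) (Rat.infReal_ne_zero x)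
    simp [abs_of_neg this]

/-! The rational part. -/

/-- The **rational part** `r(x) = sgn(x_∞) ∏_p p^{ord_p(x_p)} ∈ ℚˣ` of an idele `x` of `ℚ`:
up to the sign of `x_∞`, the positive generator of the ideal `(x) = ∏_𝔭 𝔭^{v_𝔭(x_𝔭)}`
(Neukirch's map `( ) : I_K → J_K` followed by "positive generator"), so that
`x · r(x)⁻¹ ∈ ℝ_{>0} × ∏_p ℤ_pˣ` (`I_ℚ = ℚˣ · (ℝ_{>0} × ẑˣ)`).
Ref: Neukirch, *Algebraic Number Theory*, Ch. VI §1, Prop. (1.9) and proof of Prop. (1.10).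
[cite: NeukirchANT1999, Ch. VI Prop. (1.10)] -/
def Rat.ratPart : ideleGroup ℚ →* ℚˣ where
  toFun x := Rat.infSign x * ∏ᶠ v : HeightOneSpectrum (𝓞 ℚ), Rat.primeUnit v ^ Rat.ord v x
  map_one' := by simp [Rat.ord_one]
  map_mul' x y := by
    rw [map_mul]
    simp_rw [Rat.ord_mul, zpow_add]
    rw [finprod_mul_distrib (Rat.hasFiniteMulSupport_pow_ord x) (Rat.hasFiniteMulSupport_pow_ord y)]
    simp only [mul_assoc, mul_left_comm]

/-- Unfolding `Rat.ratPart`. [folklore] -/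
theorem Rat.ratPart_apply (x : ideleGroup ℚ) :
    Rat.ratPart x = Rat.infSign x * ∏ᶠ v : HeightOneSpectrum (𝓞 ℚ), Rat.primeUnit v ^ Rat.ord v x :=
  rfl

/-! Valuations and sign of the rational part. -/

/-- `padicValRat p` on `ℚˣ`, as a hom to `Multiplicative ℤ`. [folklore] -/
def Rat.padicValRatHom (p : ℕ) [Fact p.Prime] : ℚˣ →* Multiplicative ℤ where
  toFun q := Multiplicative.ofAdd (padicValRat p (q : ℚ))
  map_one' := by simp
  map_mul' a b := by
    rw [← ofAdd_add, Units.val_mul, padicValRat.mul a.ne_zero b.ne_zero]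

/-- Unfolding `Rat.padicValRatHom`. [folklore] -/
theorem Rat.padicValRatHom_apply (p : ℕ) [Fact p.Prime] (q : ℚˣ) :
    Rat.padicValRatHom p q = Multiplicative.ofAdd (padicValRat p (q : ℚ)) := rfl

/-- `v_ℓ(p) = 0` for the primes `p ≠ ℓ` under two distinct places of `ℚ`. [folklore] -/
theorem Rat.padicValRat_natGenerator_of_ne {v w : HeightOneSpectrum (𝓞 ℚ)} (h : w ≠ v) :
    padicValRat (natGenerator v) (natGenerator w : ℚ) = 0 := by
  rw [padicValRat.of_nat, Nat.cast_eq_zero]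
  haveI := Rat.fact_prime_natGenerator w
  exact padicValNat_primes fun h' => h (Rat.natGenerator_injective h').symm

/-- **`v_p(r(x)) = ord_p(x)`**: the rational part has the same valuations as the idele.
[folklore] -/
theorem Rat.padicValRat_ratPart (x : ideleGroup ℚ) :
    padicValRat (natGenerator v) (Rat.ratPart x : ℚ) = Rat.ord v x := by
  classical
  rw [Rat.ratPart_apply, Units.val_mul, padicValRat.mul (Units.ne_zero _) (Units.ne_zero _)]
  have h1 : padicValRat (natGenerator v) (Rat.infSign x : ℚ) = 0 := by
    rw [Rat.infSign_apply]
    split_ifs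
    · simp
    · rw [Units.val_neg, Units.val_one, padicValRat.neg, padicValRat.one]
  have h2 : Rat.padicValRatHom (natGenerator v)
      (∏ᶠ w : HeightOneSpectrum (𝓞 ℚ), Rat.primeUnit w ^ Rat.ord w x) =
      ∏ᶠ w : HeightOneSpectrum (𝓞 ℚ), Rat.padicValRatHom (natGenerator v)
        (Rat.primeUnit w ^ Rat.ord w x) :=
    MonoidHom.map_finprod _ (Rat.hasFiniteMulSupport_pow_ord x)
  have h3 : ∀ w, Rat.padicValRatHom (natGenerator v) (Rat.primeUnit w ^ Rat.ord w x) =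
      Pi.mulSingle (M := fun _ => Multiplicative ℤ) v (Multiplicative.ofAdd (Rat.ord v x)) w := by
    intro w
    rw [map_zpow, Rat.padicValRatHom_apply, Rat.val_primeUnit, ← ofAdd_zsmul]
    by_cases h : w = v
    · subst h
      rw [Pi.mulSingle_eq_same, padicValRat.self (prime_natGenerator w).one_lt, smul_eq_mul,
        mul_one]
    · rw [Pi.mulSingle_eq_of_ne h, Rat.padicValRat_natGenerator_of_ne h, smul_zero]; rfl
  have h4 : (∏ᶠ w : HeightOneSpectrum (𝓞 ℚ), Rat.padicValRatHom (natGenerator v)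
      (Rat.primeUnit w ^ Rat.ord w x)) = Multiplicative.ofAdd (Rat.ord v x) := by
    rw [finprod_congr h3, finprod_eq_single _ v (fun w hw => Pi.mulSingle_eq_of_ne hw _),
      Pi.mulSingle_eq_same]
  rw [h4, Rat.padicValRatHom_apply] at h2
  rw [h1, zero_add]
  exact Multiplicative.ofAdd.injective h2

/-- The product `∏_p p^{ord_p x}` is a positive rational. [folklore] -/
theorem Rat.finprod_primeUnit_pow_pos (x : ideleGroup ℚ) :
    (0 : ℚ) < ((∏ᶠ v : HeightOneSpectrum (𝓞 ℚ), Rat.primeUnit v ^ Rat.ord v x : ℚˣ) : ℚ) := by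
  rw [← Units.coeHom_apply, MonoidHom.map_finprod _ (Rat.hasFiniteMulSupport_pow_ord x)]
  refine finprod_induction (fun t : ℚ => 0 < t) one_pos (fun _ _ => mul_pos) fun w => ?_
  simp only [Units.coeHom_apply, Units.val_zpow_eq_zpow_val, Rat.val_primeUnit]
  exact zpow_pos (by exact_mod_cast (prime_natGenerator w).pos) _

/-- `r(x) > 0 ↔ x_∞ > 0`. [folklore] -/
theorem Rat.ratPart_pos_iff (x : ideleGroup ℚ) : (0 : ℚ) < Rat.ratPart x ↔ 0 < Rat.infReal x := by
  rw [Rat.ratPart_apply, Units.val_mul, Rat.infSign_apply]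
  have hP := Rat.finprod_primeUnit_pow_pos x
  split_ifs with h
  · simp [hP, h]
  · simp only [Units.val_neg, Units.val_one, neg_mul, one_mul, Left.neg_pos_iff]
    exact ⟨fun h' => absurd hP h'.not_gt, fun h' => absurd h' h⟩

/-- **A nonzero rational is determined by its sign and its valuations.** [folklore] -/
theorem Rat.eq_of_padicValRat_eq {a b : ℚ} (ha : a ≠ 0) (hb : b ≠ 0) (hs : 0 < a ↔ 0 < b)
    (hv : ∀ p : ℕ, p.Prime → padicValRat p a = padicValRat p b) : a = b := by
  set t := a / b with ht
  have ht0 : 0 < t := by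
    rcases lt_or_gt_of_ne ha with h | h
    · exact div_pos_of_neg_of_neg h (lt_of_le_of_ne (not_lt.1 (mt hs.2 h.not_gt)) hb)
    · exact div_pos h (hs.1 h)
  have htv : ∀ p : ℕ, p.Prime → padicValRat p t = 0 := fun p hp => by
    haveI := Fact.mk hp
    rw [ht, padicValRat.div ha hb, hv p hp, sub_self]
  suffices t = 1 by
    rw [ht, div_eq_one_iff_eq hb] at this; exact this
  have hnum : 0 < t.num := Rat.num_pos.2 ht0
  have hn : t.num.natAbs ≠ 0 := by omega
  have hnd : t.num.natAbs = t.den := by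
    refine (Nat.eq_iff_prime_padicValNat_eq _ _ hn t.den_ne_zero).2 fun p hp => ?_
    haveI := Fact.mk hp
    have := htv p hp
    rw [padicValRat, padicValInt, sub_eq_zero, Nat.cast_inj] at this
    exact this
  have : t = t.num / t.den := (Rat.num_div_den t).symm
  rw [this, div_eq_one_iff_eq (by exact_mod_cast t.den_ne_zero)]
  have h' : (t.num : ℚ) = (t.num.natAbs : ℚ) := by
    rw [← Int.cast_natCast, Int.natAbs_of_nonneg hnum.le]
  rw [h', hnd]

/-- **`r((q)) = q`**: the rational part of a principal idele `(q)`, `q ∈ ℚˣ`, is `q`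
(`ℚˣ ∩ (ℝ_{>0} × ẑˣ) = 1`). Ref: Neukirch, *Algebraic Number Theory*, Ch. VI §1, proof of
Prop. (1.10). [folklore] -/
theorem Rat.ratPart_principalIdele (q : ℚˣ) : Rat.ratPart (principalIdele ℚ q) = q := by
  refine Units.ext (Rat.eq_of_padicValRat_eq (Units.ne_zero _) q.ne_zero ?_ fun p hp => ?_)
  · rw [Rat.ratPart_pos_iff, Rat.infReal_principalIdele]
    exact Rat.cast_pos
  · haveI := Fact.mk hp
    set w : HeightOneSpectrum (𝓞 ℚ) := (primesEquiv (R := 𝓞 ℚ)).symm ⟨p, hp⟩ with hw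
    have hwp : natGenerator w = p := by
      have := (primesEquiv (R := 𝓞 ℚ)).apply_symm_apply ⟨p, hp⟩
      rw [← hw] at this
      exact congrArg Subtype.val this
    rw [← hwp, Rat.padicValRat_ratPart, Rat.ord_principalIdele]

/-! The unit part. -/

/-- The **unit part** `u(x) = x · r(x)⁻¹ ∈ ℝ_{>0} × ∏_p ℤ_pˣ` of an idele `x` of `ℚ`
(`I_ℚ = ℚˣ × (ℝ_{>0} × ẑˣ)`). Ref: Neukirch, *Algebraic Number Theory*, Ch. VI §1, proof of
Prop. (1.10). [folklore] -/
def Rat.unitIdele : ideleGroup ℚ →* ideleGroup ℚ :=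
  (MonoidHom.id (ideleGroup ℚ)) * ((principalIdele ℚ).comp Rat.ratPart)⁻¹

/-- Unfolding `Rat.unitIdele`. [folklore] -/
theorem Rat.unitIdele_apply (x : ideleGroup ℚ) :
    Rat.unitIdele x = x * (principalIdele ℚ (Rat.ratPart x))⁻¹ := rfl

/-- `ord_v(u(x)) = 0`. [folklore] -/
theorem Rat.ord_unitIdele (x : ideleGroup ℚ) : Rat.ord v (Rat.unitIdele x) = 0 := by
  rw [Rat.unitIdele_apply, Rat.ord_mul, Rat.ord_inv, Rat.ord_principalIdele,
    Rat.padicValRat_ratPart, add_neg_cancel]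

/-- The finite components of `u(x)` are units. [folklore] -/
theorem Rat.valued_unitIdele (x : ideleGroup ℚ) :
    Valued.v ((Rat.unitIdele x : AdeleRing (𝓞 ℚ) ℚ).2 v) = 1 :=
  (Rat.ord_eq_zero_iff v _).1 (Rat.ord_unitIdele v x)

/-- The infinite component of `u(x)` is positive. [folklore] -/
theorem Rat.infReal_unitIdele_pos (x : ideleGroup ℚ) : 0 < Rat.infReal (Rat.unitIdele x) := by
  rw [Rat.unitIdele_apply, map_mul, map_inv, Rat.infReal_principalIdele]
  have hx := Rat.infReal_ne_zero x
  rcases lt_or_gt_of_ne hx with h | h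
  · have hr : (Rat.ratPart x : ℚ) < 0 := by
      have := (Rat.ratPart_pos_iff x).not.2 h.not_gt
      exact lt_of_le_of_ne (not_lt.1 this) (Units.ne_zero _)
    exact mul_pos_of_neg_of_neg h (inv_lt_zero.2 (by exact_mod_cast hr))
  · exact mul_pos h (inv_pos.2 (by exact_mod_cast (Rat.ratPart_pos_iff x).2 h))

/-- `u((q)) = 1` for `q ∈ ℚˣ`. [folklore] -/
theorem Rat.unitIdele_principalIdele (q : ℚˣ) : Rat.unitIdele (principalIdele ℚ q) = 1 := by
  rw [Rat.unitIdele_apply, Rat.ratPart_principalIdele, mul_inv_cancel]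

/-- If `x_∞ > 0` and all `x_v` are units then `r(x) = 1` and `u(x) = x`. [folklore] -/
theorem Rat.ratPart_eq_one (x : ideleGroup ℚ) (hinf : 0 < Rat.infReal x)
    (hv : ∀ v, Valued.v ((x : AdeleRing (𝓞 ℚ) ℚ).2 v) = 1) : Rat.ratPart x = 1 := by
  rw [Rat.ratPart_apply, Rat.infSign_apply, if_pos hinf, one_mul]
  exact finprod_eq_one_of_forall_eq_one fun w => by
    rw [(Rat.ord_eq_zero_iff w x).2 (hv w), zpow_zero]

/-- If `x_∞ > 0` and all `x_v` are units then `u(x) = x`. [folklore] -/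
theorem Rat.unitIdele_eq_self (x : ideleGroup ℚ) (hinf : 0 < Rat.infReal x)
    (hv : ∀ v, Valued.v ((x : AdeleRing (𝓞 ℚ) ℚ).2 v) = 1) : Rat.unitIdele x = x := by
  rw [Rat.unitIdele_apply, Rat.ratPart_eq_one x hinf hv, map_one, inv_one, mul_one]


end IdeleRat


/-! ### Reduction modulo `m` and the ray class map `𝕀_ℚ → (ℤ/m)ˣ` -/

section Reduction

variable (v : HeightOneSpectrum (𝓞 ℚ))

attribute [local instance] Rat.fact_prime_natGenerator

/-- `‖x_v · p^{-ord_v x}‖ = 1`. [folklore] -/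
theorem Rat.norm_padicComp_mul_zpow (x : ideleGroup ℚ) :
    ‖Rat.padicComp v x * (natGenerator v : ℚ_[natGenerator v]) ^ (-Rat.ord v x)‖ = 1 := by
  have hp : (natGenerator v : ℝ) ≠ 0 := by exact_mod_cast (prime_natGenerator v).ne_zero
  rw [norm_mul, norm_zpow, Padic.norm_p, Rat.norm_padicComp, inv_zpow', neg_neg, ← zpow_add₀ hp,
    neg_add_cancel, zpow_zero]

/-- The **unit part at `v`** of an idele `x` of `ℚ`: `x_v · p_v^{-ord_v(x_v)} ∈ ℤ_{p_v}ˣ`, a hom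
`𝕀_ℚ →* ℤ_[p_v]ˣ` (`ℚ_pˣ = p^ℤ × ℤ_pˣ`). Ref: Neukirch, *Algebraic Number Theory*, Ch. II §5,
Prop. (5.3). [folklore] -/
def Rat.padicUnitPart : ideleGroup ℚ →* ℤ_[natGenerator v]ˣ where
  toFun x := PadicInt.mkUnits (Rat.norm_padicComp_mul_zpow v x)
  map_one' := by
    refine Units.ext (PadicInt.ext ?_)
    rw [PadicInt.mkUnits_eq, map_one, Rat.ord_one, neg_zero, zpow_zero, mul_one]; rfl
  map_mul' x y := by
    refine Units.ext (PadicInt.ext ?_)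
    have hp : (natGenerator v : ℚ_[natGenerator v]) ≠ 0 := by
      exact_mod_cast (prime_natGenerator v).ne_zero
    rw [Units.val_mul, PadicInt.coe_mul, PadicInt.mkUnits_eq, PadicInt.mkUnits_eq,
      PadicInt.mkUnits_eq, map_mul, Rat.ord_mul, neg_add, zpow_add₀ hp]
    ring

/-- Unfolding `Rat.padicUnitPart` (in `ℚ_[p_v]`). [folklore] -/
theorem Rat.coe_padicUnitPart (x : ideleGroup ℚ) :
    ((Rat.padicUnitPart v x : ℤ_[natGenerator v]) : ℚ_[natGenerator v]) =
      Rat.padicComp v x * (natGenerator v : ℚ_[natGenerator v]) ^ (-Rat.ord v x) := rfl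

/-- The unit part of a `v`-unit component is the component. [folklore] -/
theorem Rat.coe_padicUnitPart_of_valued_eq_one (x : ideleGroup ℚ)
    (h : Valued.v ((x : AdeleRing (𝓞 ℚ) ℚ).2 v) = 1) :
    ((Rat.padicUnitPart v x : ℤ_[natGenerator v]) : ℚ_[natGenerator v]) = Rat.padicComp v x := by
  rw [Rat.coe_padicUnitPart, (Rat.ord_eq_zero_iff v x).2 h, neg_zero, zpow_zero, mul_one]

/-- The unit part only depends on the `v`-component. [folklore] -/
theorem Rat.padicUnitPart_congr {x y : ideleGroup ℚ}
    (h : (x : AdeleRing (𝓞 ℚ) ℚ).2 v = (y : AdeleRing (𝓞 ℚ) ℚ).2 v) :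
    Rat.padicUnitPart v x = Rat.padicUnitPart v y := by
  refine Units.ext (PadicInt.ext ?_)
  simp only [Rat.coe_padicUnitPart, Rat.ord, Rat.padicComp_apply, h]

/-- The **local reduction** `x ↦ (x_v p_v^{-ord_v x} mod p_v^k) ∈ (ℤ/p_v^k)ˣ`, a hom
`𝕀_ℚ →* (ℤ/p_v^k)ˣ` (Mathlib `PadicInt.toZModPow`). [folklore] -/
def Rat.localRed (k : ℕ) : ideleGroup ℚ →* (ZMod (natGenerator v ^ k))ˣ :=
  (Units.map (PadicInt.toZModPow k :
      ℤ_[natGenerator v] →+* ZMod (natGenerator v ^ k)).toMonoidHom).comp (Rat.padicUnitPart v)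

/-- Unfolding `Rat.localRed`. [folklore] -/
theorem Rat.val_localRed (k : ℕ) (x : ideleGroup ℚ) :
    (Rat.localRed v k x : ZMod (natGenerator v ^ k)) =
      PadicInt.toZModPow k (Rat.padicUnitPart v x : ℤ_[natGenerator v]) := rfl

/-- `localRed` only depends on the `v`-component. [folklore] -/
theorem Rat.localRed_congr (k : ℕ) {x y : ideleGroup ℚ}
    (h : (x : AdeleRing (𝓞 ℚ) ℚ).2 v = (y : AdeleRing (𝓞 ℚ) ℚ).2 v) :
    Rat.localRed v k x = Rat.localRed v k y := by
  refine Units.ext ?_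
  rw [Rat.val_localRed, Rat.val_localRed, Rat.padicUnitPart_congr v h]

/-- `localRed v k x = 1` if `x_v = 1`. [folklore] -/
theorem Rat.localRed_eq_one_of_snd_eq_one (k : ℕ) {x : ideleGroup ℚ}
    (h : (x : AdeleRing (𝓞 ℚ) ℚ).2 v = 1) : Rat.localRed v k x = 1 := by
  rw [Rat.localRed_congr v k (y := 1) (by rw [h]; rfl), map_one]

/-- `localRed v k x = 1` if `x_v ∈ 1 + p_v^k ℤ_{p_v}`. [folklore] -/
theorem Rat.localRed_eq_one_of_valued_sub_one_le (k : ℕ) {x : ideleGroup ℚ}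
    (h1 : Valued.v ((x : AdeleRing (𝓞 ℚ) ℚ).2 v) = 1)
    (h2 : Valued.v ((x : AdeleRing (𝓞 ℚ) ℚ).2 v - 1) ≤ WithZero.exp (-(k : ℤ))) :
    Rat.localRed v k x = 1 := by
  refine Units.ext ?_
  rw [Rat.val_localRed, Units.val_one, ← sub_eq_zero, ← (PadicInt.toZModPow k).map_one,
    ← map_sub, ← RingHom.mem_ker, PadicInt.ker_toZModPow, ← PadicInt.norm_le_pow_iff_mem_span_pow,
    PadicInt.norm_def, PadicInt.coe_sub, Rat.coe_padicUnitPart_of_valued_eq_one v x h1,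
    PadicInt.coe_one, Rat.padicComp_apply, ← (Rat.toPadic v).map_one, ← map_sub]
  exact (Rat.valued_le_iff_norm_toPadic_le v _ k).1 h2

/-- The local reduction of the principal idele of an integer `n` prime to `p_v` is `n mod p_v^k`.
[folklore] -/
theorem Rat.localRed_principalIdele_natCast (k : ℕ) {n : ℕ} (hn : n.Coprime (natGenerator v))
    (hn0 : (n : ℚ) ≠ 0) :
    Rat.localRed v k (principalIdele ℚ (Units.mk0 (n : ℚ) hn0)) =
      ZMod.unitOfCoprime n (hn.pow_right k) := by
  refine Units.ext ?_
  rw [Rat.val_localRed, ZMod.coe_unitOfCoprime]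
  have hval :
      Valued.v ((principalIdele ℚ (Units.mk0 (n : ℚ) hn0) : AdeleRing (𝓞 ℚ) ℚ).2 v) = 1 := by
    rw [principalIdele_snd, valued_algebraMap_adicCompletion, Units.val_mk0, ← Int.cast_natCast]
    exact Rat.valuation_intCast_eq_one v (by
      rw [Int.natCast_dvd_natCast]
      exact fun h => (prime_natGenerator v).one_lt.ne'
        (Nat.Coprime.eq_one_of_dvd (Nat.Coprime.symm hn) h))
  have : (Rat.padicUnitPart v (principalIdele ℚ (Units.mk0 (n : ℚ) hn0)) : ℤ_[natGenerator v]) =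
      (n : ℤ_[natGenerator v]) := by
    refine PadicInt.ext ?_
    rw [Rat.coe_padicUnitPart_of_valued_eq_one v _ hval, Rat.padicComp_apply, principalIdele_snd,
      Rat.toPadic_algebraMap, Units.val_mk0, Rat.cast_natCast, PadicInt.coe_natCast]
  rw [this, map_natCast]

variable (m : ℕ)

/-- The place of `ℚ` over a prime factor `q` of `m`. [folklore] -/
def Rat.placeOfFactor (q : m.primeFactors) : HeightOneSpectrum (𝓞 ℚ) :=
  (primesEquiv (R := 𝓞 ℚ)).symm ⟨q, Nat.prime_of_mem_primeFactors q.2⟩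

/-- `p_{v_q} = q`. [folklore] -/
theorem Rat.natGenerator_placeOfFactor (q : m.primeFactors) :
    natGenerator (Rat.placeOfFactor m q) = q :=
  congrArg Subtype.val ((primesEquiv (R := 𝓞 ℚ)).apply_symm_apply _)

/-- `p_{v_q}^{e} = q^{e}`. [folklore] -/
theorem Rat.natGenerator_placeOfFactor_pow (q : m.primeFactors) :
    natGenerator (Rat.placeOfFactor m q) ^ m.factorization q = (q : ℕ) ^ m.factorization q := by
  rw [Rat.natGenerator_placeOfFactor]

/-- `q ∣ m` for `q ∈ m.primeFactors`, phrased for the place `v_q`. [folklore] -/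
theorem Rat.natGenerator_placeOfFactor_dvd (q : m.primeFactors) :
    natGenerator (Rat.placeOfFactor m q) ∣ m := by
  rw [Rat.natGenerator_placeOfFactor]; exact Nat.dvd_of_mem_primeFactors q.2

/-- The family of local reductions at the prime factors of `m` (transported to `ZMod (q ^ e_q)`).
[folklore] -/
def Rat.localRedFactor (q : m.primeFactors) :
    ideleGroup ℚ →* (ZMod ((q : ℕ) ^ m.factorization q))ˣ :=
  (Units.map (ZMod.ringEquivCongr
      (Rat.natGenerator_placeOfFactor_pow m q)).toRingHom.toMonoidHom).comp
    (Rat.localRed (Rat.placeOfFactor m q) (m.factorization q))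

/-- Unfolding `Rat.localRedFactor`. [folklore] -/
theorem Rat.val_localRedFactor (q : m.primeFactors) (x : ideleGroup ℚ) :
    (Rat.localRedFactor m q x : ZMod ((q : ℕ) ^ m.factorization q)) =
      ZMod.ringEquivCongr (Rat.natGenerator_placeOfFactor_pow m q)
        (Rat.localRed (Rat.placeOfFactor m q) (m.factorization q) x : ZMod _) := rfl

/-- A place not dividing `m` is not a place over a prime factor of `m`. [folklore] -/
theorem Rat.placeOfFactor_ne {w : HeightOneSpectrum (𝓞 ℚ)} (hw : ¬ natGenerator w ∣ m)
    (q : m.primeFactors) : Rat.placeOfFactor m q ≠ w := by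
  rintro rfl
  exact hw (Rat.natGenerator_placeOfFactor_dvd m q)

variable [NeZero m]

/-- The **reduction mod `m`** of (the unit parts at `q ∣ m` of) an idele of `ℚ`:
`x ↦ (x_q q^{-ord_q x} mod q^{e_q})_q ∈ ∏_{q^e ‖ m} (ℤ/q^e)ˣ = (ℤ/m)ˣ` (Chinese remainder theorem,
Mathlib `ZMod.equivPi`). [folklore] -/
def Rat.redMod : ideleGroup ℚ →* (ZMod m)ˣ :=
  (Units.map (ZMod.equivPi (n := m) (NeZero.ne m)).symm.toRingHom.toMonoidHom).comp <|
    (MulEquiv.piUnits (M := fun q : m.primeFactors => ZMod ((q : ℕ) ^ m.factorization q))).symm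
      |>.toMonoidHom.comp (MonoidHom.pi (Rat.localRedFactor m))

/-- The components of `redMod m x` under the Chinese remainder isomorphism. [folklore] -/
theorem Rat.equivPi_redMod (x : ideleGroup ℚ) (q : m.primeFactors) :
    ZMod.equivPi (n := m) (NeZero.ne m) (Rat.redMod m x : ZMod m) q =
      (Rat.localRedFactor m q x : ZMod _) := by
  change ZMod.equivPi (n := m) (NeZero.ne m) ((ZMod.equivPi (n := m) (NeZero.ne m)).symm _) q = _
  rw [RingEquiv.apply_symm_apply]
  rfl

/-- `redMod m x = 1` when `x_q = 1` at every `q ∣ m`. [folklore] -/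
theorem Rat.redMod_eq_one {x : ideleGroup ℚ}
    (h : ∀ q : m.primeFactors, Rat.localRed (Rat.placeOfFactor m q) (m.factorization q) x = 1) :
    Rat.redMod m x = 1 := by
  refine Units.ext ((ZMod.equivPi (n := m) (NeZero.ne m)).injective (funext fun q => ?_))
  rw [Rat.equivPi_redMod, Rat.val_localRedFactor, h q, Units.val_one, map_one, Units.val_one,
    map_one, Pi.one_apply]

/-- `redMod m x = 1` when `x_q = 1` at every place `q ∣ m`. [folklore] -/
theorem Rat.redMod_eq_one_of_snd_eq_one {x : ideleGroup ℚ}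
    (h : ∀ q : m.primeFactors, (x : AdeleRing (𝓞 ℚ) ℚ).2 (Rat.placeOfFactor m q) = 1) :
    Rat.redMod m x = 1 :=
  Rat.redMod_eq_one m fun q => Rat.localRed_eq_one_of_snd_eq_one _ _ (h q)

/-- `redMod m x = 1` when all `x_v` are units and `x_q ≡ 1 (mod q^{e_q})` for `q^{e_q} ‖ m`.
[folklore] -/
theorem Rat.redMod_eq_one_of_valued {x : ideleGroup ℚ}
    (h1 : ∀ v, Valued.v ((x : AdeleRing (𝓞 ℚ) ℚ).2 v) = 1)
    (h2 : ∀ q : m.primeFactors, Valued.v ((x : AdeleRing (𝓞 ℚ) ℚ).2 (Rat.placeOfFactor m q) - 1) ≤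
      WithZero.exp (-(m.factorization q : ℤ))) :
    Rat.redMod m x = 1 :=
  Rat.redMod_eq_one m fun q => Rat.localRed_eq_one_of_valued_sub_one_le _ _ (h1 _) (h2 q)

/-- `redMod m (n) = n mod m` for a natural number `n` prime to `m`. [folklore] -/
theorem Rat.redMod_principalIdele_natCast {n : ℕ} (hn : n.Coprime m) (hn0 : (n : ℚ) ≠ 0) :
    Rat.redMod m (principalIdele ℚ (Units.mk0 (n : ℚ) hn0)) = ZMod.unitOfCoprime n hn := by
  refine Units.ext ((ZMod.equivPi (n := m) (NeZero.ne m)).injective (funext fun q => ?_))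
  have hq : n.Coprime (natGenerator (Rat.placeOfFactor m q)) :=
    Nat.Coprime.coprime_dvd_right (Rat.natGenerator_placeOfFactor_dvd m q) hn
  rw [Rat.equivPi_redMod, Rat.val_localRedFactor, Rat.localRed_principalIdele_natCast _ _ hq,
    ZMod.coe_unitOfCoprime, ZMod.coe_unitOfCoprime, map_natCast, map_natCast, Pi.natCast_apply]

/-- **The ray class map mod `m`** of `ℚ`: `𝕀_ℚ → 𝕀_ℚ / (ℚˣ · ℝ_{>0} · I_f^{(m)}) ≅ (ℤ/mℤ)ˣ`,
`x ↦ (u(x) mod m)` where `u(x) = x · r(x)⁻¹ ∈ ℝ_{>0} × ẑˣ` is the unit part of `x`.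
Ref: Neukirch, *Algebraic Number Theory*, Ch. VI §1, Prop. (1.9) and Prop. (1.10)
(`C_ℚ/C_ℚ^𝔪 ≅ Cl_ℚ^𝔪 ≅ (ℤ/mℤ)ˣ`). [cite: NeukirchANT1999, Ch. VI Prop. (1.10)] -/
def Rat.rayClassHom : ideleGroup ℚ →* (ZMod m)ˣ := (Rat.redMod m).comp Rat.unitIdele

/-- Unfolding `Rat.rayClassHom`. [folklore] -/
theorem Rat.rayClassHom_apply (x : ideleGroup ℚ) :
    Rat.rayClassHom m x = Rat.redMod m (Rat.unitIdele x) := rfl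

/-- The ray class map kills principal ideles. [folklore] -/
theorem Rat.rayClassHom_principalIdele (q : ℚˣ) : Rat.rayClassHom m (principalIdele ℚ q) = 1 := by
  rw [Rat.rayClassHom_apply, Rat.unitIdele_principalIdele, map_one]

/-- On `ℝ_{>0} × ẑˣ` the ray class map is the reduction mod `m`. [folklore] -/
theorem Rat.rayClassHom_eq_redMod (x : ideleGroup ℚ) (hinf : 0 < Rat.infReal x)
    (hv : ∀ v, Valued.v ((x : AdeleRing (𝓞 ℚ) ℚ).2 v) = 1) :
    Rat.rayClassHom m x = Rat.redMod m x := by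
  rw [Rat.rayClassHom_apply, Rat.unitIdele_eq_self x hinf hv]

/-- The infinite component of a local idele `⟨u⟩_w` is `1`. [folklore] -/
theorem Rat.infReal_localUnits (w : HeightOneSpectrum (𝓞 ℚ)) (u : (w.adicCompletion ℚ)ˣ) :
    Rat.infReal (localUnits w u) = 1 := by
  rw [Rat.infReal_apply, localUnits_fst]
  exact map_one (Rat.completionRealEquiv Rat.infinitePlace)

/-- The components of a local idele `⟨u⟩_w` with `u ∈ ℤ_wˣ` are units. [folklore] -/
theorem Rat.valued_localUnits (w : HeightOneSpectrum (𝓞 ℚ)) (u : (w.adicCompletion ℚ)ˣ)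
    (hu : Valued.v (u : w.adicCompletion ℚ) = 1) (v : HeightOneSpectrum (𝓞 ℚ)) :
    Valued.v ((localUnits w u : AdeleRing (𝓞 ℚ) ℚ).2 v) = 1 := by
  by_cases h : v = w
  · subst h; rwa [localUnits_snd_apply_self]
  · rw [localUnits_snd_apply_of_ne _ h, map_one]

/-- **Unramified outside `m`**: the ray class map kills `⟨u⟩_w`, `u ∈ ℤ_wˣ`, for `p_w ∤ m`.
Ref: Neukirch, *Algebraic Number Theory*, Ch. VI §1, (1.9) (`U_𝔭 ⊆ I^𝔪` for `𝔭 ∤ 𝔪`). [folklore] -/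
theorem Rat.rayClassHom_localUnits_eq_one {w : HeightOneSpectrum (𝓞 ℚ)} (hw : ¬ natGenerator w ∣ m)
    (u : (w.adicCompletion ℚ)ˣ) (hu : Valued.v (u : w.adicCompletion ℚ) = 1) :
    Rat.rayClassHom m (localUnits w u) = 1 := by
  rw [Rat.rayClassHom_eq_redMod m _ (by rw [Rat.infReal_localUnits]; exact one_pos)
    (Rat.valued_localUnits w u hu)]
  exact Rat.redMod_eq_one_of_snd_eq_one m fun q =>
    localUnits_snd_apply_of_ne _ (Rat.placeOfFactor_ne m hw q)

/-- The uniformizer `p_w ∈ ℚ_wˣ`. [folklore] -/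
def Rat.primeLocalUnit (w : HeightOneSpectrum (𝓞 ℚ)) : (w.adicCompletion ℚ)ˣ :=
  Units.mk0 ((natGenerator w : ℕ) : w.adicCompletion ℚ) (Rat.natGenerator_ne_zero' w)

/-- `v(p_w) = ϖ`. [folklore] -/
theorem Rat.valued_primeLocalUnit (w : HeightOneSpectrum (𝓞 ℚ)) :
    Valued.v (Rat.primeLocalUnit w : w.adicCompletion ℚ) = WithZero.exp (-1 : ℤ) :=
  Rat.valued_natGenerator w

open scoped Classical in
/-- `ord_v ⟨p_w⟩_w = [v = w]`. [folklore] -/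
theorem Rat.ord_localUnits_primeLocalUnit (w v : HeightOneSpectrum (𝓞 ℚ)) :
    Rat.ord v (localUnits w (Rat.primeLocalUnit w)) = if v = w then 1 else 0 := by
  split_ifs with h
  · subst h
    unfold Rat.ord
    rw [Rat.padicComp_apply, localUnits_snd_apply_self, Rat.primeLocalUnit, Units.val_mk0,
      map_natCast]
    exact Padic.valuation_p
  · rw [Rat.ord_eq_zero_iff, localUnits_snd_apply_of_ne _ h, map_one]

/-- `r(⟨p_w⟩_w) = p_w`. [folklore] -/
theorem Rat.ratPart_localUnits_primeLocalUnit (w : HeightOneSpectrum (𝓞 ℚ)) :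
    Rat.ratPart (localUnits w (Rat.primeLocalUnit w)) = Rat.primeUnit w := by
  classical
  rw [Rat.ratPart_apply, Rat.infSign_apply, Rat.infReal_localUnits, if_pos one_pos, one_mul]
  rw [finprod_eq_single _ w fun v hv => by
    rw [Rat.ord_localUnits_primeLocalUnit, if_neg hv, zpow_zero]]
  rw [Rat.ord_localUnits_primeLocalUnit, if_pos rfl, zpow_one]

/-- **The value at `⟨p_w⟩_w`** (`p_w ∤ m`): the ray class map sends the uniformizer idele at `w` to
`(p_w mod m)⁻¹` (the idele `⟨p⟩_p · (p)⁻¹` is `p⁻¹ ∈ ℤ_qˣ` at every `q ∣ m`).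
Ref: Neukirch, *Algebraic Number Theory*, Ch. VI §1, proof of Prop. (1.10); Ch. VII §6, the map
`c : 𝔭 ↦ ⟨π_𝔭⟩` before Prop. (6.13). [cite: NeukirchANT1999, Ch. VI Prop. (1.10)] -/
theorem Rat.rayClassHom_localUnits_primeLocalUnit {w : HeightOneSpectrum (𝓞 ℚ)}
    (hw : ¬ natGenerator w ∣ m) :
    Rat.rayClassHom m (localUnits w (Rat.primeLocalUnit w)) =
      (ZMod.unitOfCoprime (natGenerator w)
        ((Nat.Prime.coprime_iff_not_dvd (prime_natGenerator w)).2 hw))⁻¹ := by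
  have hp0 : ((natGenerator w : ℕ) : ℚ) ≠ 0 := by exact_mod_cast (prime_natGenerator w).ne_zero
  have hpu : Rat.primeUnit w = Units.mk0 ((natGenerator w : ℕ) : ℚ) hp0 := Units.ext rfl
  rw [Rat.rayClassHom_apply, Rat.unitIdele_apply, Rat.ratPart_localUnits_primeLocalUnit, map_mul,
    map_inv, hpu, Rat.redMod_principalIdele_natCast m _ hp0,
    Rat.redMod_eq_one_of_snd_eq_one m fun q =>
      localUnits_snd_apply_of_ne _ (Rat.placeOfFactor_ne m hw q), one_mul]

end Reduction

/-! ### The Hecke character of a Dirichlet character -/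

section OfDirichlet

variable (v : HeightOneSpectrum (𝓞 ℚ))

attribute [local instance] Rat.fact_prime_natGenerator

/-- `Rat.infReal` is continuous. [folklore] -/
theorem Rat.continuous_infReal : Continuous Rat.infReal := by
  change Continuous fun x : ideleGroup ℚ =>
    Rat.completionRealEquiv Rat.infinitePlace ((x : AdeleRing (𝓞 ℚ) ℚ).1 Rat.infinitePlace)
  refine (InfinitePlace.Completion.isometry_extensionEmbeddingOfIsReal
    (Rat.isReal_infinitePlace' Rat.infinitePlace)).continuous.comp ?_
  exact (continuous_apply Rat.infinitePlace).comp (continuous_fst.comp Units.continuous_val)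

/-- Ideles near `1` have positive infinite component. [folklore] -/
theorem Rat.eventually_infReal_pos : ∀ᶠ x : ideleGroup ℚ in 𝓝 1, 0 < Rat.infReal x := by
  have : Rat.infReal ⁻¹' Set.Ioi 0 ∈ 𝓝 (1 : ideleGroup ℚ) :=
    Rat.continuous_infReal.continuousAt.preimage_mem_nhds (by
      rw [map_one]; exact Ioi_mem_nhds one_pos)
  exact this

omit v in
/-- Ideles near `1` have unit finite components (`∏_v 𝒪_v` is open in `𝔸_{K,f}`). [folklore] -/
theorem eventually_valued_snd_eq_one {K : Type*} [Field K] [NumberField K] :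
    ∀ᶠ x : ideleGroup K in 𝓝 1, ∀ v, Valued.v ((x : AdeleRing (𝓞 K) K).2 v) = 1 := by
  have hO : IsOpen {f : FiniteAdeleRing (𝓞 K) K | ∀ v, f v ∈ v.adicCompletionIntegers K} :=
    RestrictedProduct.isOpen_forall_mem fun v => Valued.isOpen_valuationSubring _
  have hc : Continuous fun x : ideleGroup K => (x : AdeleRing (𝓞 K) K).2 :=
    continuous_snd.comp Units.continuous_val
  have h1 : {x : ideleGroup K | ∀ v, (x : AdeleRing (𝓞 K) K).2 v ∈ v.adicCompletionIntegers K} ∈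
      𝓝 (1 : ideleGroup K) :=
    (hO.preimage hc).mem_nhds fun v => (v.adicCompletionIntegers K).one_mem
  have h2 : {x : ideleGroup K | ∀ v, ((x⁻¹ : ideleGroup K) : AdeleRing (𝓞 K) K).2 v ∈
      v.adicCompletionIntegers K} ∈ 𝓝 (1 : ideleGroup K) :=
    (hO.preimage (hc.comp continuous_inv)).mem_nhds fun v => by
      change (((1 : ideleGroup K)⁻¹ : ideleGroup K) : AdeleRing (𝓞 K) K).2 v ∈ _
      rw [inv_one]; exact (v.adicCompletionIntegers K).one_mem
  filter_upwards [h1, h2] with x hx hx' v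
  refine le_antisymm (hx v) ?_
  have h := hx' v
  change Valued.v (((x⁻¹ : ideleGroup K) : AdeleRing (𝓞 K) K).2 v) ≤ 1 at h
  rw [ideleGroup_val_inv_snd, map_inv₀,
    inv_le_one₀ (zero_lt_iff.2 ((map_ne_zero _).2 (ideleGroup_snd_ne_zero x v)))] at h
  exact h

/-- The congruence ball `1 + p_v^k ℤ_{p_v}` is a neighbourhood of `1` in `ℚ_v`. [folklore] -/
theorem Rat.ball_mem_nhds_one (k : ℕ) :
    {y : v.adicCompletion ℚ | Valued.v (y - 1) ≤ WithZero.exp (-(k : ℤ))} ∈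
      𝓝 (1 : v.adicCompletion ℚ) := by
  set π : v.adicCompletion ℚ := ((natGenerator v : ℕ) : v.adicCompletion ℚ) with hπ
  have hπ0 : π ≠ 0 := Rat.natGenerator_ne_zero' v
  have hπv : Valued.v (π ^ k) = WithZero.exp (-(k : ℤ)) := by
    rw [map_pow, hπ, Rat.valued_natGenerator, ← WithZero.exp_nsmul]; simp
  have hc : Continuous fun y : v.adicCompletion ℚ => (y - 1) * (π ^ k)⁻¹ :=
    (continuous_sub_right _).mul continuous_const
  have hmem : (fun y : v.adicCompletion ℚ => (y - 1) * (π ^ k)⁻¹) ⁻¹'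
      (v.adicCompletionIntegers ℚ : Set (v.adicCompletion ℚ)) ∈ 𝓝 (1 : v.adicCompletion ℚ) :=
    hc.continuousAt.preimage_mem_nhds ((Valued.isOpen_valuationSubring _).mem_nhds (by
      simp only [sub_self, zero_mul, SetLike.mem_coe]; exact zero_mem _))
  refine Filter.mem_of_superset hmem fun y hy => ?_
  simp only [Set.mem_preimage, SetLike.mem_coe, HeightOneSpectrum.mem_adicCompletionIntegers,
    map_mul, map_inv₀, hπv] at hy
  rw [Set.mem_setOf_eq]
  have h' := mul_le_mul_right hy (WithZero.exp (-(k : ℤ)))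
  rwa [mul_one, mul_left_comm, mul_inv_cancel₀ WithZero.exp_ne_zero, mul_one] at h'

/-- Ideles near `1` satisfy `x_v ≡ 1 (mod p_v^k)`. [folklore] -/
theorem Rat.eventually_valued_sub_one_le (k : ℕ) :
    ∀ᶠ x : ideleGroup ℚ in 𝓝 1,
      Valued.v ((x : AdeleRing (𝓞 ℚ) ℚ).2 v - 1) ≤ WithZero.exp (-(k : ℤ)) := by
  have hc : Continuous fun x : ideleGroup ℚ => (x : AdeleRing (𝓞 ℚ) ℚ).2 v :=
    (RestrictedProduct.continuous_eval v).comp (continuous_snd.comp Units.continuous_val)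
  have ht : Tendsto (fun x : ideleGroup ℚ => (x : AdeleRing (𝓞 ℚ) ℚ).2 v) (𝓝 1) (𝓝 1) :=
    hc.tendsto' 1 1 rfl
  exact ht (Rat.ball_mem_nhds_one v k)

variable (m : ℕ) [NeZero m]

/-- **Continuity**: the ray class map mod `m` is trivial on a neighbourhood of `1` (it kills the
open subgroup `ℝ_{>0} × I_f^{(m)}`). Ref: Neukirch, *Algebraic Number Theory*, Ch. VI §1, proof of
Prop. (1.8) (`I_K^𝔪` is open). [folklore] -/
theorem Rat.rayClassHom_eventually_eq_one :
    ∀ᶠ x : ideleGroup ℚ in 𝓝 1, Rat.rayClassHom m x = 1 := by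
  have h3 : ∀ᶠ x : ideleGroup ℚ in 𝓝 1, ∀ q : m.primeFactors,
      Valued.v ((x : AdeleRing (𝓞 ℚ) ℚ).2 (Rat.placeOfFactor m q) - 1) ≤
        WithZero.exp (-(m.factorization q : ℤ)) :=
    Filter.eventually_all.2 fun q => Rat.eventually_valued_sub_one_le _ _
  filter_upwards [Rat.eventually_infReal_pos, eventually_valued_snd_eq_one, h3] with x h1 h2 h3
  rw [Rat.rayClassHom_eq_redMod m x h1 h2]
  exact Rat.redMod_eq_one_of_valued m h2 h3

variable {m}
variable (χ : DirichletCharacter ℂ m)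

/-- The hom `x ↦ χ(rayClassHom m x)⁻¹ : 𝕀_ℚ →* ℂˣ` underlying the Hecke character of `χ`.
[folklore] -/
def Rat.dirichletToHeckeHom : ideleGroup ℚ →* ℂˣ :=
  ((MulChar.toUnitHom χ).comp (Rat.rayClassHom m))⁻¹

/-- Unfolding `Rat.dirichletToHeckeHom`. [folklore] -/
theorem Rat.dirichletToHeckeHom_apply (x : ideleGroup ℚ) :
    Rat.dirichletToHeckeHom χ x = (MulChar.toUnitHom χ (Rat.rayClassHom m x))⁻¹ := rfl

/-- `Rat.dirichletToHeckeHom χ` is locally constant at `1`, hence continuous. [folklore] -/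
theorem Rat.continuous_dirichletToHeckeHom : Continuous (Rat.dirichletToHeckeHom χ) := by
  refine continuous_of_continuousAt_one _ ?_
  have h : (fun _ : ideleGroup ℚ => (1 : ℂˣ)) =ᶠ[𝓝 1] Rat.dirichletToHeckeHom χ := by
    filter_upwards [Rat.rayClassHom_eventually_eq_one m] with x hx
    rw [Rat.dirichletToHeckeHom_apply, hx, map_one, inv_one]
  have := (tendsto_const_nhds (x := (1 : ℂˣ)) (f := 𝓝 (1 : ideleGroup ℚ))).congr' h
  rwa [ContinuousAt, map_one]

/-- **The Hecke character of a Dirichlet character** `χ` mod `m`: the finite-order Hecke character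
`ψ_χ(x) = χ(u(x) mod m)⁻¹` of `ℚ`, where `u(x) ∈ ℝ_{>0} × ẑˣ` is the unit part of the idele `x`
(`𝕀_ℚ = ℚˣ × ℝ_{>0} × ẑˣ`); normalised so that `ψ_χ(⟨ϖ_p⟩) = χ(p)` for `p ∤ m`.
Ref: Neukirch, *Algebraic Number Theory*, Ch. VII §6, Prop. (6.9) with (6.12)–(6.14), and
Ch. VI §1, Prop. (1.10). [cite: NeukirchANT1999, Ch. VII Prop. (6.9)] -/
def HeckeCharacter.ofDirichlet : HeckeCharacter ℚ where
  toContinuousMonoidHom :=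
    { toMonoidHom := Rat.dirichletToHeckeHom χ
      continuous_toFun := Rat.continuous_dirichletToHeckeHom χ }
  map_principal' x hx := by
    obtain ⟨q, rfl⟩ := hx
    change Rat.dirichletToHeckeHom χ (principalIdele ℚ q) = 1
    rw [Rat.dirichletToHeckeHom_apply, Rat.rayClassHom_principalIdele, map_one, inv_one]

/-- Unfolding `HeckeCharacter.ofDirichlet`. [folklore] -/
theorem HeckeCharacter.ofDirichlet_apply (x : ideleGroup ℚ) :
    HeckeCharacter.ofDirichlet χ x = (MulChar.toUnitHom χ (Rat.rayClassHom m x))⁻¹ := rfl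

/-- `ψ_χ` has finite order (dividing `#(ℤ/m)ˣ`). [folklore] -/
theorem HeckeCharacter.isFiniteOrder_ofDirichlet :
    (HeckeCharacter.ofDirichlet χ).IsFiniteOrder := by
  refine isOfFinOrder_iff_pow_eq_one.2 ⟨Fintype.card (ZMod m)ˣ, Fintype.card_pos, ?_⟩
  refine HeckeCharacter.ext fun x => ?_
  rw [HeckeCharacter.pow_apply, HeckeCharacter.ofDirichlet_apply, inv_pow, ← map_pow,
    pow_card_eq_one, map_one, inv_one, HeckeCharacter.one_apply]

/-- `ψ_χ` is unramified at `p ∤ m`. [folklore] -/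
theorem HeckeCharacter.isUnramifiedAt_ofDirichlet {v : HeightOneSpectrum (𝓞 ℚ)}
    (hv : ¬ natGenerator v ∣ m) : (HeckeCharacter.ofDirichlet χ).IsUnramifiedAt v := by
  intro u
  set U : (v.adicCompletion ℚ)ˣ := Units.map ((v.adicCompletionIntegers ℚ).subtype : _ →* _) u
    with hU
  have hU1 : Valued.v (U : v.adicCompletion ℚ) = 1 :=
    HeightOneSpectrum.adicCompletionIntegers.isUnit_iff_valued_eq_one.1 u.isUnit
  rw [HeckeCharacter.localComponent_apply, HeckeCharacter.ofDirichlet_apply,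
    Rat.rayClassHom_localUnits_eq_one m hv U hU1, map_one, inv_one]

/-- **`ψ_χ(⟨ϖ_p⟩) = χ(p)` for `p ∤ m`.** [folklore] -/
theorem HeckeCharacter.valueAtUniformizer_ofDirichlet {v : HeightOneSpectrum (𝓞 ℚ)}
    (hv : ¬ natGenerator v ∣ m) :
    (HeckeCharacter.ofDirichlet χ).valueAtUniformizer v = χ (v.residueCard : ZMod m) := by
  rw [← HeckeCharacter.localComponent_eq_valueAtUniformizer
    (HeckeCharacter.isUnramifiedAt_ofDirichlet χ hv) (Rat.valued_primeLocalUnit v),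
    HeckeCharacter.localComponent_apply, HeckeCharacter.ofDirichlet_apply,
    Rat.rayClassHom_localUnits_primeLocalUnit m hv, map_inv, inv_inv, MulChar.coe_toUnitHom,
    ZMod.coe_unitOfCoprime, Rat.residueCard_eq_natGenerator]

end OfDirichlet

/-! ### Uniqueness: a finite-order Hecke character of `ℚ` is determined by almost all `ψ(ϖ_p)` -/

section Uniqueness

variable (v : HeightOneSpectrum (𝓞 ℚ))

attribute [local instance] Rat.fact_prime_natGenerator

/-- The infinite idele `(t, 1, 1, …)` of a real number `t ≠ 0` (`ℝˣ = (ℚ ⊗ ℝ)ˣ ↪ 𝕀_ℚ`).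
Ref: Neukirch, *Algebraic Number Theory*, Ch. VI §1. [folklore] -/
def Rat.infIdele : ℝˣ →* ideleGroup ℚ :=
  (infiniteIdeles ℚ).comp (Units.map (RingHom.pi fun w : InfinitePlace ℚ =>
    ((Rat.completionRealEquiv w).symm : ℝ ≃+* w.Completion).toRingHom).toMonoidHom)

/-- Infinite component of `Rat.infIdele t`. [folklore] -/
theorem Rat.infIdele_fst_apply (t : ℝˣ) (w : InfinitePlace ℚ) :
    (Rat.infIdele t : AdeleRing (𝓞 ℚ) ℚ).1 w = (Rat.completionRealEquiv w).symm (t : ℝ) := rfl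

/-- Finite components of `Rat.infIdele t` are `1`. [folklore] -/
@[simp] theorem Rat.infIdele_snd (t : ℝˣ) (w : HeightOneSpectrum (𝓞 ℚ)) :
    (Rat.infIdele t : AdeleRing (𝓞 ℚ) ℚ).2 w = 1 := rfl

/-- `infReal (infIdele t) = t`. [folklore] -/
@[simp] theorem Rat.infReal_infIdele (t : ℝˣ) : Rat.infReal (Rat.infIdele t) = t := by
  rw [Rat.infReal_apply, Rat.infIdele_fst_apply, RingEquiv.apply_symm_apply]

/-- A finite-order Hecke character of `ℚ` is trivial on `ℝ_{>0} ⊆ ℝˣ = (ℚ ⊗ ℝ)ˣ` (positive reals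
are `n`-th powers). Ref: Neukirch, *Algebraic Number Theory*, Ch. VII §6, proof of Prop. (6.9)
(`χ_∞(ℝ_{(+)}^*) = 1`). [folklore] -/
theorem HeckeCharacter.Rat.map_infIdele_of_pos {ψ : HeckeCharacter ℚ} (hψ : ψ.IsFiniteOrder)
    {t : ℝ} (ht : 0 < t) : ψ (Rat.infIdele (Units.mk0 t ht.ne')) = 1 := by
  obtain ⟨n, hn, hψn⟩ := hψ.exists_pow_eq_one
  have hs : 0 < t ^ (n⁻¹ : ℝ) := Real.rpow_pos_of_pos ht _
  have : Units.mk0 t ht.ne' = Units.mk0 (t ^ (n⁻¹ : ℝ)) hs.ne' ^ n :=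
    Units.ext (by rw [Units.val_pow_eq_pow_val, Units.val_mk0, Units.val_mk0,
      Real.rpow_inv_natCast_pow ht.le hn.ne'])
  rw [this, map_pow, map_pow, ← HeckeCharacter.pow_apply, hψn, HeckeCharacter.one_apply]

/-- **Density of `ℕ` in `ℤ_p`**: a `v`-adic integer is congruent mod `p_v^k` to a natural number.
[folklore] -/
theorem Rat.exists_nat_valued_sub_le (u : v.adicCompletion ℚ) (hu : Valued.v u ≤ 1) (k : ℕ) :
    ∃ d : ℕ, Valued.v (u - d) ≤ WithZero.exp (-(k : ℤ)) := by
  set x : ℤ_[natGenerator v] := ⟨Rat.toPadic v u, (Rat.norm_toPadic_le_one_iff v u).2 hu⟩ with hx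
  refine ⟨(PadicInt.toZModPow k x).val, ?_⟩
  rw [Rat.valued_le_iff_norm_toPadic_le, map_sub, map_natCast]
  have hmem : x - ((PadicInt.toZModPow k x).val : ℤ_[natGenerator v]) ∈
      RingHom.ker (PadicInt.toZModPow k : ℤ_[natGenerator v] →+* ZMod (natGenerator v ^ k)) := by
    rw [RingHom.mem_ker, map_sub, map_natCast, ZMod.natCast_zmod_val, sub_self]
  rw [PadicInt.ker_toZModPow, ← PadicInt.norm_le_pow_iff_mem_span_pow, PadicInt.norm_def,
    PadicInt.coe_sub, PadicInt.coe_natCast] at hmem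
  exact hmem

/-- The valuation in `ℚ_v` of a rational number. [folklore] -/
theorem Rat.valued_ratCast (q : ℚ) : Valued.v ((q : ℚ) : v.adicCompletion ℚ) = v.valuation ℚ q := by
  rw [← eq_ratCast (algebraMap ℚ (v.adicCompletion ℚ)) q, valued_algebraMap_adicCompletion]

/-- The valuation in `ℚ_v` of a natural number. [folklore] -/
theorem Rat.valued_natCast (n : ℕ) :
    Valued.v ((n : ℕ) : v.adicCompletion ℚ) = v.valuation ℚ (n : ℚ) := by
  rw [← map_natCast (algebraMap ℚ (v.adicCompletion ℚ)), valued_algebraMap_adicCompletion]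

/-- **Chinese remainder step**: a `v`-adic integer `u` is congruent mod `p_v^{e_v}` to a positive
integer `d ≡ 1 (mod p_w^{e_w})` for the other places `w` of a finite set `T`.
Ref: Neukirch, *Algebraic Number Theory*, Ch. VI §1, proof of Prop. (1.9) (approximation
theorem). [folklore] -/
theorem Rat.exists_nat_crt (T : Finset (HeightOneSpectrum (𝓞 ℚ))) (e : HeightOneSpectrum (𝓞 ℚ) → ℕ)
    (u : v.adicCompletion ℚ) (hu : Valued.v u ≤ 1) :
    ∃ d : ℕ, 0 < d ∧ Valued.v (u - d) ≤ WithZero.exp (-(e v : ℤ)) ∧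
      ∀ w ∈ T, w ≠ v → w.valuation ℚ ((d : ℚ) - 1) ≤ WithZero.exp (-(e w : ℤ)) := by
  classical
  obtain ⟨d₀, hd₀⟩ := Rat.exists_nat_valued_sub_le v u hu (e v)
  set p := natGenerator v with hp
  set k := e v with hk
  set M : ℕ := ∏ w ∈ T.erase v, natGenerator w ^ e w with hM
  have hMcop : M.Coprime (p ^ k) := by
    refine Nat.Coprime.pow_right _ (Nat.Coprime.prod_left fun w hw => Nat.Coprime.pow_left _ ?_)
    rw [Nat.coprime_primes (prime_natGenerator w) (prime_natGenerator v)]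
    exact fun h => (Finset.mem_erase.1 hw).1 (Rat.natGenerator_injective h)
  haveI : NeZero (p ^ k) := ⟨pow_ne_zero _ (prime_natGenerator v).ne_zero⟩
  set c : ZMod (p ^ k) :=
    ((d₀ : ZMod (p ^ k)) - 1) * ((ZMod.unitOfCoprime M hMcop)⁻¹ : (ZMod (p ^ k))ˣ) with hc
  set d : ℕ := 1 + M * c.val with hd
  have hdmod : (d : ZMod (p ^ k)) = d₀ := by
    have hMu : (M : ZMod (p ^ k)) * ((ZMod.unitOfCoprime M hMcop)⁻¹ : (ZMod (p ^ k))ˣ) = 1 := by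
      rw [← ZMod.coe_unitOfCoprime M hMcop]; exact Units.mul_inv _
    rw [hd, Nat.cast_add, Nat.cast_one, Nat.cast_mul, ZMod.natCast_zmod_val, hc, mul_left_comm,
      hMu, mul_one, add_sub_cancel]
  have hdvd : ((p : ℤ) ^ k) ∣ (d : ℤ) - d₀ := by
    have := (ZMod.intCast_eq_intCast_iff_dvd_sub (d₀ : ℤ) (d : ℤ) (p ^ k)).1 (by
      push_cast; exact hdmod.symm)
    exact_mod_cast this
  refine ⟨d, by omega, ?_, fun w hw hwv => ?_⟩
  · have h1 : Valued.v ((d : v.adicCompletion ℚ) - d₀) ≤ WithZero.exp (-(k : ℤ)) := by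
      have := Rat.valuation_intCast_le v hdvd
      rw [← valued_algebraMap_adicCompletion, Int.cast_sub, Int.cast_natCast, Int.cast_natCast,
        map_sub, map_natCast, map_natCast] at this
      exact this
    have : u - d = (u - d₀) - ((d : v.adicCompletion ℚ) - d₀) := by ring
    rw [this]
    exact Valuation.map_sub_le _ hd₀ h1
  · have hwdvd : ((natGenerator w : ℤ) ^ e w) ∣ (d : ℤ) - 1 := by
      have h1 : (natGenerator w ^ e w : ℕ) ∣ M :=
        Finset.dvd_prod_of_mem _ (Finset.mem_erase.2 ⟨hwv, hw⟩)
      have h2 : (M : ℤ) ∣ (d : ℤ) - 1 := ⟨c.val, by rw [hd]; push_cast; ring⟩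
      exact (Int.natCast_dvd_natCast.2 h1 |>.trans (by exact_mod_cast h2))
    have := Rat.valuation_intCast_le w hwdvd
    push_cast at this
    exact this

end Uniqueness

section UniquenessMain

variable {ψ : HeckeCharacter ℚ}

/-- An unramified character kills `⟨u⟩_v` for `u ∈ K_vˣ` of valuation `1` (i.e. `u ∈ 𝒪_vˣ`).
[folklore] -/
theorem HeckeCharacter.IsUnramifiedAt.map_localUnits_eq_one {K : Type*} [Field K] [NumberField K]
    {χ : HeckeCharacter K} {v : HeightOneSpectrum (𝓞 K)} (h : χ.IsUnramifiedAt v)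
    (u : (v.adicCompletion K)ˣ) (hu : Valued.v (u : v.adicCompletion K) = 1) :
    χ (localUnits v u) = 1 := by
  have hu' : Valued.v ((u⁻¹ : (v.adicCompletion K)ˣ) : v.adicCompletion K) = 1 := by
    rw [Units.val_inv_eq_inv_val, map_inv₀, hu, inv_one]
  let w : (v.adicCompletionIntegers K)ˣ :=
    ⟨⟨(u : v.adicCompletion K), hu.le⟩, ⟨((u⁻¹ : (v.adicCompletion K)ˣ) : v.adicCompletion K),
      hu'.le⟩, Subtype.ext u.mul_inv, Subtype.ext u.inv_mul⟩
  have hmap : Units.map ((v.adicCompletionIntegers K).subtype : _ →* _) w = u := Units.ext rfl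
  have := h w
  rwa [hmap, HeckeCharacter.localComponent_apply] at this

/-- **`ψ(ℚ_pˣ) = 1` at an unramified `p` with `ψ(ϖ_p) = 1`** (`ℚ_pˣ = p^ℤ × ℤ_pˣ`). [folklore] -/
theorem HeckeCharacter.map_localUnits_of_valueAtUniformizer_eq_one {K : Type*} [Field K]
    [NumberField K] {χ : HeckeCharacter K} {v : HeightOneSpectrum (𝓞 K)} (h1 : χ.IsUnramifiedAt v)
    (h2 : χ.valueAtUniformizer v = 1) (z : (v.adicCompletion K)ˣ) : χ (localUnits v z) = 1 := by
  set π := HeckeCharacter.uniformizer K v with hπ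
  have hz0 : Valued.v (z : v.adicCompletion K) ≠ 0 := (map_ne_zero _).2 z.ne_zero
  set a : ℤ := WithZero.log (Valued.v (z : v.adicCompletion K)) with ha
  have hza : Valued.v (z : v.adicCompletion K) = WithZero.exp a := (WithZero.exp_log hz0).symm
  have hu : Valued.v ((z * π ^ a : (v.adicCompletion K)ˣ) : v.adicCompletion K) = 1 := by
    rw [Units.val_mul, Units.val_zpow_eq_zpow_val, map_mul, map_zpow₀, hza,
      HeckeCharacter.valued_uniformizer, ← WithZero.exp_zsmul, smul_eq_mul, mul_neg, mul_one,
      ← WithZero.exp_add, add_neg_cancel, WithZero.exp_zero]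
  have hπ1 : χ (localUnits v π) = 1 := by
    have := HeckeCharacter.localComponent_eq_valueAtUniformizer h1
      (HeckeCharacter.valued_uniformizer v)
    rw [h2, HeckeCharacter.localComponent_apply, Units.val_eq_one] at this
    exact this
  have : z = (z * π ^ a) * π ^ (-a) := by
    rw [mul_assoc, ← zpow_add, add_neg_cancel, zpow_zero, mul_one]
  rw [this, map_mul, map_mul, map_zpow, map_zpow, hπ1, one_zpow, mul_one]
  exact h1.map_localUnits_eq_one _ hu

/-- **The approximation step** (Neukirch, Ch. VI §1, proof of (1.9), for `K = ℚ`): if `ψ` has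
module of definition `(T, e)` (`e ≥ 1`) and kills `⟨ℚ_wˣ⟩` for all `w ∉ T`, then `ψ` kills
`⟨u⟩_v` for every `v` and every `u ∈ ℤ_vˣ`: writing `u ≡ d (mod p_v^{e_v})` with `d ∈ ℕ`,
`d ≡ 1 (mod p_w^{e_w})` (`w ∈ T ∖ {v}`), the idele `⟨u⟩_v (d)⁻¹ (d)_∞ ∏_{ℓ ∣ d} ⟨d⟩_ℓ` lies in
`I_f^𝔪`. Ref: Neukirch, *Algebraic Number Theory*, Ch. VI §1, Prop. (1.9); Ch. VII §6, (6.13).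
[cite: NeukirchANT1999, Ch. VI Prop. (1.9)] -/
theorem HeckeCharacter.Rat.map_localUnits_of_isModulus (hψ : ψ.IsFiniteOrder)
    {T : Finset (HeightOneSpectrum (𝓞 ℚ))} {e : HeightOneSpectrum (𝓞 ℚ) → ℕ}
    (hmod : HeckeCharacter.IsModulus ψ T e) (he : ∀ w, 1 ≤ e w)
    (hT : ∀ w ∉ T, ∀ z : (w.adicCompletion ℚ)ˣ, ψ (localUnits w z) = 1)
    (v : HeightOneSpectrum (𝓞 ℚ)) (u : (v.adicCompletion ℚ)ˣ)
    (hu : Valued.v (u : v.adicCompletion ℚ) = 1) : ψ (localUnits v u) = 1 := by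
  classical
  by_cases hv : v ∈ T
  swap
  · -- `v ∉ T`: `⟨u⟩_v ∈ I_f^𝔪`
    refine hmod _ (localUnits_fst v u) (Rat.valued_localUnits v u hu) fun w hw => ?_
    rw [localUnits_snd_apply_of_ne _ (by rintro rfl; exact hv hw), sub_self, map_zero]
    exact zero_le
  -- `v ∈ T`: Chinese remainder
  obtain ⟨d, hd0, hd1, hd2⟩ := Rat.exists_nat_crt v T e u hu.le
  have hdq : (d : ℚ) ≠ 0 := by exact_mod_cast hd0.ne'
  set du : ℚˣ := Units.mk0 (d : ℚ) hdq with hdu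
  have hlt : ∀ w, WithZero.exp (-(e w : ℤ)) < 1 := fun w => by
    rw [← WithZero.exp_zero, WithZero.exp_lt_exp]; have := he w; omega
  -- valuations of `d`
  have hdv : Valued.v ((d : ℕ) : v.adicCompletion ℚ) = 1 := by
    have : Valued.v ((u : v.adicCompletion ℚ) - ((u : v.adicCompletion ℚ) - d)) = 1 := by
      rw [Valuation.map_sub_eq_of_lt_left _ (by rw [hu]; exact hd1.trans_lt (hlt v)), hu]
    rwa [sub_sub_cancel] at this
  have hdT : ∀ w ∈ T, w.valuation ℚ (d : ℚ) = 1 := by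
    intro w hw
    by_cases hwv : w = v
    · subst hwv; rwa [← Rat.valued_natCast]
    · have := Valuation.map_one_add_of_lt (w.valuation ℚ) ((hd2 w hw hwv).trans_lt (hlt w))
      rwa [add_sub_cancel] at this
  -- the places dividing `d`
  set F : Finset (HeightOneSpectrum (𝓞 ℚ)) := d.primeFactors.attach.image
    fun q : {x // x ∈ d.primeFactors} =>
      (primesEquiv (R := 𝓞 ℚ)).symm ⟨(q : ℕ), (Nat.mem_primeFactors.1 q.2).1⟩ with hF
  have hFdvd : ∀ w, w ∈ F ↔ natGenerator w ∣ d := by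
    intro w
    constructor
    · intro hw
      obtain ⟨q, -, rfl⟩ := Finset.mem_image.1 hw
      have : natGenerator
          ((primesEquiv (R := 𝓞 ℚ)).symm ⟨(q : ℕ), (Nat.mem_primeFactors.1 q.2).1⟩) = (q : ℕ) :=
        congrArg Subtype.val ((primesEquiv (R := 𝓞 ℚ)).apply_symm_apply _)
      rw [this]; exact (Nat.mem_primeFactors.1 q.2).2.1
    · intro hw
      refine Finset.mem_image.2 ⟨⟨natGenerator w, Nat.mem_primeFactors.2
        ⟨prime_natGenerator w, hw, hd0.ne'⟩⟩, Finset.mem_attach _ _, ?_⟩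
      exact (primesEquiv (R := 𝓞 ℚ)).symm_apply_apply w
  have hFT : ∀ w ∈ F, w ∉ T := by
    intro w hw hwT
    have h1 := hdT w hwT
    rw [Rat.valuation_natCast, HeightOneSpectrum.intValuation_eq_one_iff,
      Rat.natCast_mem_asIdeal_iff] at h1
    exact h1 ((hFdvd w).1 hw)
  have hdF : ∀ w ∉ F, w.valuation ℚ (d : ℚ) = 1 := by
    intro w hw
    rw [Rat.valuation_natCast, HeightOneSpectrum.intValuation_eq_one_iff,
      Rat.natCast_mem_asIdeal_iff]
    exact fun h => hw ((hFdvd w).2 h)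
  -- the ideles
  set D : ideleGroup ℚ := principalIdele ℚ du with hD
  set I : ideleGroup ℚ := infiniteIdeles ℚ (globalToInfiniteUnits ℚ du) with hI
  set G : ideleGroup ℚ := ∏ w ∈ F, localUnits w (globalToLocalUnits w du)⁻¹ with hG
  set Y : ideleGroup ℚ := localUnits v u * D⁻¹ * I with hY
  have hdw : ∀ w : HeightOneSpectrum (𝓞 ℚ),
      (D : AdeleRing (𝓞 ℚ) ℚ).2 w = ((d : ℕ) : w.adicCompletion ℚ) := by
    intro w; rw [hD, principalIdele_snd, hdu, Units.val_mk0, map_natCast]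
  have hdw0 : ∀ w : HeightOneSpectrum (𝓞 ℚ), ((d : ℕ) : w.adicCompletion ℚ) ≠ 0 := fun w => by
    rw [← map_natCast (algebraMap ℚ (w.adicCompletion ℚ))]
    exact (map_ne_zero _).2 hdq
  have hYG : ψ (Y * G⁻¹) = 1 := by
    refine hmod _ ?_ (fun w => ?_) (fun w hw => ?_)
    · rw [ideleGroup_val_fst_mul, hY, ideleGroup_val_fst_mul, ideleGroup_val_fst_mul,
        localUnits_fst, one_mul, hI, infiniteIdeles_fst, val_globalToInfiniteUnits, hD,
        ← map_inv (principalIdele ℚ) du, principalIdele_fst, ← map_mul, Units.inv_mul, map_one,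
        one_mul]
      have := ideleGroup_val_inv_fst_mul G
      rwa [hG, fst_prod_localUnits, mul_one] at this
    · rw [ideleGroup_val_snd_mul, ideleGroup_val_inv_snd, hG, snd_prod_localUnits, hY,
        ideleGroup_val_snd_mul, ideleGroup_val_snd_mul, hI, infiniteIdeles_snd, mul_one,
        ideleGroup_val_inv_snd, hdw]
      by_cases hwF : w ∈ F
      · rw [if_pos hwF, localUnits_snd_apply_of_ne _ (by rintro rfl; exact hFT _ hwF hv), one_mul,
          Units.val_inv_eq_inv_val, val_globalToLocalUnits, hdu, Units.val_mk0, map_natCast,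
          mul_inv_cancel₀ (inv_ne_zero (hdw0 w)), map_one]
      · rw [if_neg hwF, inv_one, mul_one, map_mul, map_inv₀, Rat.valued_natCast, hdF w hwF, inv_one,
          mul_one]
        by_cases hwv : w = v
        · subst hwv; rwa [localUnits_snd_apply_self]
        · rw [localUnits_snd_apply_of_ne _ hwv, map_one]
    · have hwF : w ∉ F := fun h => hFT w h hw
      rw [ideleGroup_val_snd_mul, ideleGroup_val_inv_snd, hG, snd_prod_localUnits, if_neg hwF,
        inv_one, mul_one, hY, ideleGroup_val_snd_mul, ideleGroup_val_snd_mul, hI,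
        infiniteIdeles_snd, mul_one, ideleGroup_val_inv_snd, hdw]
      have hdw1 : Valued.v ((d : ℕ) : w.adicCompletion ℚ) = 1 := by
        rw [Rat.valued_natCast]; exact hdT w hw
      by_cases hwv : w = v
      · subst hwv
        rw [localUnits_snd_apply_self]
        have : (u : w.adicCompletion ℚ) * ((d : ℕ) : w.adicCompletion ℚ)⁻¹ - 1 =
            ((u : w.adicCompletion ℚ) - d) * ((d : ℕ) : w.adicCompletion ℚ)⁻¹ := by
          rw [sub_mul, mul_inv_cancel₀ (hdw0 w)]
        rw [this, map_mul, map_inv₀, hdw1, inv_one, mul_one]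
        exact hd1
      · rw [localUnits_snd_apply_of_ne _ hwv, one_mul]
        have : ((d : ℕ) : w.adicCompletion ℚ)⁻¹ - 1 =
            -((((d : ℕ) : w.adicCompletion ℚ) - 1) * ((d : ℕ) : w.adicCompletion ℚ)⁻¹) := by
          rw [sub_mul, mul_inv_cancel₀ (hdw0 w), neg_sub, one_mul]
        rw [this, Valuation.map_neg, map_mul, map_inv₀, hdw1, inv_one, mul_one, ← Nat.cast_one,
          ← map_natCast (algebraMap ℚ (w.adicCompletion ℚ)) d,
          ← map_natCast (algebraMap ℚ (w.adicCompletion ℚ)) 1, ← map_sub,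
          valued_algebraMap_adicCompletion, Nat.cast_one]
        exact hd2 w hw hwv
  have hGψ : ψ G = 1 := by
    rw [hG, map_prod]
    exact Finset.prod_eq_one fun w hw => hT w (hFT w hw) _
  have hDψ : ψ D = 1 := ψ.map_principal (principalIdele_mem du)
  have hIψ : ψ I = 1 := HeckeCharacter.Rat.map_infiniteIdeles_natCast hψ d hdq
  have : localUnits v u = Y * G⁻¹ * G * D * I⁻¹ := by
    rw [inv_mul_cancel_right, hY, mul_assoc _ I D, mul_comm I D, ← mul_assoc, inv_mul_cancel_right,
      mul_inv_cancel_right]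
  rw [this, map_mul, map_mul, map_mul, map_inv, hYG, hGψ, hDψ, hIψ, inv_one, mul_one, mul_one,
    mul_one]

/-- The place over a prime `p ∣ m` is one of the `placeOfFactor m q`. [folklore] -/
theorem Rat.exists_placeOfFactor_eq {m : ℕ} [NeZero m] {w : HeightOneSpectrum (𝓞 ℚ)}
    (hw : natGenerator w ∣ m) : ∃ q : m.primeFactors, Rat.placeOfFactor m q = w :=
  ⟨⟨natGenerator w, Nat.mem_primeFactors.2 ⟨prime_natGenerator w, hw, NeZero.ne m⟩⟩,
    (primesEquiv (R := 𝓞 ℚ)).symm_apply_apply w⟩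

/-- **Uniqueness** (Neukirch, Ch. VII §6, Cor. (6.14) with Ch. VI §1, (1.9)–(1.10), for `K = ℚ`):
a finite-order Hecke character `ψ` of `ℚ` which is unramified with `ψ(ϖ_p) = 1` at every
`p ∤ m` is trivial: `ψ` has a module of definition `𝔪` (which we may take divisible by the primes
of `m`), `C_ℚ/C_ℚ^𝔪` is generated by the classes of the `⟨π_p⟩`, `p ∤ 𝔪` and of `ℝ_{>0}`,
`ℤ_pˣ` (`p ∣ 𝔪`), and `ψ` kills all of these (the last by the approximation step
`map_localUnits_of_isModulus`). [cite: NeukirchANT1999, Ch. VII Cor. (6.14)] -/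
theorem HeckeCharacter.Rat.eq_one_of_forall {m : ℕ} [NeZero m] (hψ : ψ.IsFiniteOrder)
    (h : ∀ v : HeightOneSpectrum (𝓞 ℚ), ¬ natGenerator v ∣ m →
      ψ.IsUnramifiedAt v ∧ ψ.valueAtUniformizer v = 1) : ψ = 1 := by
  classical
  obtain ⟨T₀, hT₀, e₀, hmod₀⟩ := HeckeCharacter.exists_moduleOfDefinition_of_isFiniteOrder hψ
  set T : Finset (HeightOneSpectrum (𝓞 ℚ)) :=
    hT₀.toFinset ∪ Finset.univ.image (Rat.placeOfFactor m) with hT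
  set e : HeightOneSpectrum (𝓞 ℚ) → ℕ := fun w => e₀ w + 1 with he
  have hmod : HeckeCharacter.IsModulus ψ T e := by
    intro x h1 h2 h3
    refine hmod₀ x h1 h2 fun w hw =>
      (h3 w (Finset.mem_union_left _ (hT₀.mem_toFinset.2 hw))).trans ?_
    rw [WithZero.exp_le_exp]
    change -((e₀ w + 1 : ℕ) : ℤ) ≤ -(e₀ w : ℤ)
    push_cast; omega
  have he1 : ∀ w, 1 ≤ e w := fun w => by change 1 ≤ e₀ w + 1; omega
  have hT' : ∀ w ∉ T, ∀ z : (w.adicCompletion ℚ)ˣ, ψ (localUnits w z) = 1 := by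
    intro w hw z
    have hwm : ¬ natGenerator w ∣ m := fun hdvd => by
      obtain ⟨q, hq⟩ := Rat.exists_placeOfFactor_eq hdvd
      exact hw (Finset.mem_union_right _ (Finset.mem_image.2 ⟨q, Finset.mem_univ _, hq⟩))
    exact HeckeCharacter.map_localUnits_of_valueAtUniformizer_eq_one (h w hwm).1 (h w hwm).2 z
  refine HeckeCharacter.ext fun x => ?_
  rw [HeckeCharacter.one_apply]
  -- `x = u(x) · (r(x))`
  have hx : x = Rat.unitIdele x * principalIdele ℚ (Rat.ratPart x) := by
    rw [Rat.unitIdele_apply, inv_mul_cancel_right]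
  set u := Rat.unitIdele x with hu
  have hupos : 0 < Rat.infReal u := Rat.infReal_unitIdele_pos x
  have huv : ∀ w, Valued.v ((u : AdeleRing (𝓞 ℚ) ℚ).2 w) = 1 := fun w => Rat.valued_unitIdele w x
  -- remove the infinite component
  set t : ℝˣ := Units.mk0 (Rat.infReal u) hupos.ne' with ht
  set u' : ideleGroup ℚ := u * (Rat.infIdele t)⁻¹ with hu'
  have hu'1 : (u' : AdeleRing (𝓞 ℚ) ℚ).1 = 1 := by
    funext w
    obtain rfl : w = Rat.infinitePlace := Subsingleton.elim _ _
    rw [hu', ideleGroup_val_fst_mul, ← map_inv]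
    change (u : AdeleRing (𝓞 ℚ) ℚ).1 Rat.infinitePlace *
      (Rat.infIdele t⁻¹ : AdeleRing (𝓞 ℚ) ℚ).1 Rat.infinitePlace = 1
    rw [Rat.infIdele_fst_apply, Units.val_inv_eq_inv_val, ht, Units.val_mk0, Rat.infReal_apply,
      ← map_inv₀, RingEquiv.symm_apply_apply, mul_inv_cancel₀]
    intro h0
    apply hupos.ne'
    rw [Rat.infReal_apply, h0, map_zero]
  have hu'2 : ∀ w, (u' : AdeleRing (𝓞 ℚ) ℚ).2 w = (u : AdeleRing (𝓞 ℚ) ℚ).2 w := by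
    intro w
    rw [hu', ideleGroup_val_snd_mul, ideleGroup_val_inv_snd, Rat.infIdele_snd, inv_one, mul_one]
  -- remove the components at `T`
  set z : ∀ w : HeightOneSpectrum (𝓞 ℚ), (w.adicCompletion ℚ)ˣ := fun w =>
    Units.mk0 ((u : AdeleRing (𝓞 ℚ) ℚ).2 w) (ideleGroup_snd_ne_zero u w) with hz
  set G : ideleGroup ℚ := ∏ w ∈ T, localUnits w (z w) with hG
  have hGψ : ψ G = 1 := by
    rw [hG, map_prod]
    exact Finset.prod_eq_one fun w _ =>
      HeckeCharacter.Rat.map_localUnits_of_isModulus hψ hmod he1 hT' w (z w) (huv w)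
  have hmain : ψ (u' * G⁻¹) = 1 := by
    refine hmod _ ?_ (fun w => ?_) (fun w hw => ?_)
    · rw [ideleGroup_val_fst_mul, hu'1, one_mul]
      have := ideleGroup_val_inv_fst_mul G
      rwa [hG, fst_prod_localUnits, mul_one] at this
    · rw [ideleGroup_val_snd_mul, ideleGroup_val_inv_snd, hG, snd_prod_localUnits, hu'2]
      split_ifs with hwT
      · rw [hz, Units.val_mk0, mul_inv_cancel₀ (ideleGroup_snd_ne_zero u w), map_one]
      · rw [inv_one, mul_one]; exact huv w
    · rw [ideleGroup_val_snd_mul, ideleGroup_val_inv_snd, hG, snd_prod_localUnits, hu'2, if_pos hw,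
        hz, Units.val_mk0, mul_inv_cancel₀ (ideleGroup_snd_ne_zero u w), sub_self, map_zero]
      exact zero_le
  have htψ : ψ (Rat.infIdele t) = 1 := HeckeCharacter.Rat.map_infIdele_of_pos hψ hupos
  have hdecomp : x = u' * G⁻¹ * G * Rat.infIdele t * principalIdele ℚ (Rat.ratPart x) := by
    rw [inv_mul_cancel_right, hu', inv_mul_cancel_right, ← hx]
  rw [hdecomp, map_mul, map_mul, map_mul, hmain, hGψ, htψ,
    ψ.map_principal (principalIdele_mem _), one_mul, one_mul, one_mul]

/-- `χ(p) ≠ 0` for `p ∤ m`. [folklore] -/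
theorem Rat.dirichletCharacter_apply_ne_zero {m : ℕ} [NeZero m] (χ : DirichletCharacter ℂ m)
    {p : ℕ} (hp : p.Coprime m) : χ (p : ZMod m) ≠ 0 := by
  rw [← ZMod.coe_unitOfCoprime p hp, ← MulChar.coe_toUnitHom]
  exact Units.ne_zero _

/-- **Hecke characters of `ℚ` of finite order come from Dirichlet characters** (discharge of the
named fact `HeckeCharacter.exists_of_dirichletCharacter`): for every Dirichlet character `χ`
mod `m` there is a unique finite-order Hecke character `ψ` of `ℚ` with `ψ` unramified and
`ψ(ϖ_p) = χ(p)` at every `p ∤ m`.  Existence: `ψ = HeckeCharacter.ofDirichlet χ`, i.e.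
`ψ(x) = χ(u(x) mod m)⁻¹` with `u(x) ∈ ℝ_{>0} × ẑˣ` the unit part of `x ∈ 𝕀_ℚ = ℚˣ × ℝ_{>0} × ẑˣ`
(Neukirch's `C_ℚ/C_ℚ^𝔪 ≅ (ℤ/mℤ)ˣ`, Ch. VI (1.10), composed with `χ⁻¹`; the inverse makes
`ψ(⟨ϖ_p⟩) = χ(p)`, matching `χ ↦ χ ∘ c`, `c(𝔭) = ⟨π_𝔭⟩`, of Ch. VII (6.13)–(6.14)).  Uniqueness:
`HeckeCharacter.Rat.eq_one_of_forall` applied to `ψ₁ψ₂⁻¹`.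
Ref: Neukirch, *Algebraic Number Theory*, Ch. VII §6, Prop. (6.9) (Dirichlet characters mod `𝔪`
are the Größencharaktere mod `𝔪` of type `(p, 0)`), (6.11)–(6.14); Ch. VI §1, Prop. (1.9),
(1.10) (pp. 419–425 and 324–327 of the held PDF). [cite: NeukirchANT1999, Ch. VII Prop. (6.9)] -/
theorem HeckeCharacter.exists_of_dirichletCharacter_holds :
    HeckeCharacter.exists_of_dirichletCharacter := by
  intro m _ χ
  refine ⟨HeckeCharacter.ofDirichlet χ,
    ⟨HeckeCharacter.isFiniteOrder_ofDirichlet χ, fun v hv => ?_⟩, ?_⟩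
  · rw [Rat.natCast_mem_asIdeal_iff] at hv
    exact ⟨HeckeCharacter.isUnramifiedAt_ofDirichlet χ hv,
      HeckeCharacter.valueAtUniformizer_ofDirichlet χ hv⟩
  · rintro ψ ⟨hψ, hspec⟩
    have key : ψ * (HeckeCharacter.ofDirichlet χ)⁻¹ = 1 := by
      refine HeckeCharacter.Rat.eq_one_of_forall (m := m)
        (hψ.mul (HeckeCharacter.isFiniteOrder_ofDirichlet χ).inv) fun v hv => ?_
      have hv' : (m : 𝓞 ℚ) ∉ v.asIdeal := by rwa [Rat.natCast_mem_asIdeal_iff]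
      obtain ⟨h1, h2⟩ := hspec v hv'
      have h3 := HeckeCharacter.isUnramifiedAt_ofDirichlet χ hv
      have h4 := HeckeCharacter.valueAtUniformizer_ofDirichlet χ hv
      have hunr : (ψ * (HeckeCharacter.ofDirichlet χ)⁻¹).IsUnramifiedAt v := by
        intro w
        rw [HeckeCharacter.localComponent_apply, HeckeCharacter.mul_apply, HeckeCharacter.inv_apply,
          ← HeckeCharacter.localComponent_apply, ← HeckeCharacter.localComponent_apply, h1 w, h3 w,
          inv_one, mul_one]
      refine ⟨hunr, ?_⟩
      have hp : (v.residueCard).Coprime m := by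
        rw [Rat.residueCard_eq_natGenerator]
        exact (Nat.Prime.coprime_iff_not_dvd (prime_natGenerator v)).2 hv
      unfold HeckeCharacter.valueAtUniformizer at h2 h4 ⊢
      rw [HeckeCharacter.localComponent_apply, HeckeCharacter.mul_apply, HeckeCharacter.inv_apply,
        ← HeckeCharacter.localComponent_apply, ← HeckeCharacter.localComponent_apply, Units.val_mul,
        Units.val_inv_eq_inv_val, h2, h4]
      exact mul_inv_cancel₀ (Rat.dirichletCharacter_apply_ne_zero χ hp)
    exact mul_inv_eq_one.1 key

end UniquenessMain

end Literature.NumberTheory.GaloisRepresentations
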